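import Summits.AtomisticToContinuum.HydrodynamicLimit.Theses.AntiMazurCoboundaries
import Summits.AtomisticToContinuum.HydrodynamicLimit.Theses.FluxGibbsianityLdDrude
import Literature.MathematicalPhysics.KineticTheory.HardSphereEulerDim
import Literature.MathematicalPhysics.KineticTheory.HardSphereEulerProofs
import Literature.MathematicalPhysics.KineticTheory.HardSphereEulerLLN
import Literature.Analysis.FluidPDE.HardSphereAlexander
import Literature.Analysis.FunctionSpaces.FlatTorus
import Literature.Analysis.FunctionSpaces.TorusSpaceTime
import Literature.Analysis.FunctionSpaces.BochnerProofs
import Summits.AtomisticToContinuum.HydrodynamicLimit.Theorems.PolynomialCompression.Negative.PdeForm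
import Summits.AtomisticToContinuum.HydrodynamicLimit.Theorems.PolynomialCompression.Negative.Statics
import Summits.AtomisticToContinuum.HydrodynamicLimit.Theorems.JParityClosureOddContactSymmetryGibbsInvariance

/-!
# Disproof of `KineticWindowGronwall` — findings (cdisprove standing adversary, cycles 1–3)

Crux `Summit.AtomisticToContinuum.HydrodynamicLimit.Theses.AntiMazurCoboundaries.KineticWindowGronwall`
(stmt-AtomisticToContinuum-9282, shared with route FluxGibbsianityLdDrude; `rfl`-equal decls, §0):
the bare implication `KineticFluxLdDecay → RelEntropyVanishing` (A → B below).

VERDICT SO FAR: **RESISTS**. `¬(A → B) ↔ A ∧ ¬B` (§1): a kill must PROVE A (uniform-in-N large-deviation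
decay of kinetic-window fluxes for deterministic hard spheres at fixed reduced density — open, no proof
technology at fixed σ) AND REFUTE B (Yau-form hydrodynamic limit — believed true; not refutable on any
classical hs-Euler solution that can be written down without the equation of state, §5).
Everything below is `lean check`ed; sorry-free unless a docstring says NEAR-MISS; standard axioms.

FINDINGS (section map):
* §0 the shared item: the two routes' decls are the same term (`rfl`).
* §1 LOGICAL NORMAL FORM: `not_crux_iff` (¬crux ↔ A ∧ ¬B), `crux_of_consequent`, `crux_of_not_antecedent`,
  `crux_iff_consequent_of_antecedent`. Consequence for everybody: this crux has NO content of its own that a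
  refuter can attack without deciding A or B; its difficulty is exactly `B given A`.
* §2 LOAD-BEARING (consequent side): the `t = 0` TIE of `RelEntropyVanishing` is necessary —
  `RelEntropyVanishingUntied` (B with the hypothesis `TendstoHydroFieldsAt … 0 →` deleted, all else verbatim)
  is FALSE (`relEntropyVanishingUntied_false`): the constant state `(ρ, u, θ) ≡ (2, 0, 1)` is a classical
  hs-Euler solution for every σ (all derivatives vanish, whatever the EOS), its mass is `2`, while the empirical
  density of `χ ≡ 1` is identically `1` under every law — so NO activity `a` gives the exponential
  concentration clause. Hence `crux_untied_false_of_antecedent : A → ¬(A → B_untied)`: the Gronwall must be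
  anchored in the pinned initial data (`H(f₀|ψ₀) = 0` AND `ψ_t` driven by the Euler solution WITH THE TIED DATA).
* §3 LOAD-BEARING (consequent side): the EULER EQUATIONS are necessary — `RelEntropyVanishingNoPDE` (B with
  `IsHardSphereEulerSolution σ T ρ u θ` weakened to positivity of `θ`, all else verbatim) is FALSE
  (`relEntropyVanishingNoPDE_false`): tie the data honestly (tree LLN `localGibbs_lln_holds`) and double the
  density at `t = 1/2`; tied mass is `1` (χ ≡ 1), doubled mass is `2`.
* §4 METHOD OBSTRUCTION made checkable (the HighMomentumCutoff barrier bites HERE): the entropy inequality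
  `∫X df ≤ β⁻¹[H(f|ψ) + log ∫e^{βX} dψ]` is VOID for the energy current, whose one-body symbol is cubic in `v`:
  `lintegral_exp_mul_pow_three_eq_top` — `∫ exp(α x³) dγ(x) = ∞` for every `α > 0` under the standard
  Gaussian `γ` on `ℝ` (hence under every Maxwellian, in every frame). So the informal proof plan's step
  "the tail by a truncation statement under f_t (GIVEN)" cannot be discharged by the entropy method itself;
  it is an a-priori estimate under the TRUE law (`Literature.Barriers.AtomisticToContinuum.HighMomentumCutoff`,
  open, "no proof even in the classical case").
* §4b VACUITY MAP: `ConsequentAt` (B's body, `Iff.rfl`-faithful) holds on CONSTANT tied data for every flow family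
  and horizon as soon as the homogeneous Gibbs laws concentrate exponentially (`consequentAt_const_of_concentration`:
  reference activity `a ≡ 1`, `(Φ_t)_# G_N = G_N` from the tree, `klDiv_self`) — statics only, no use of A.
* §5 WHY IT RESISTS (docstring `why_it_resists`): the full junk audit of A and B and the list of attacks;
  `discreteWindowGronwall(_exp)`: the per-window log-moment bound enters ONCE times `T/γ` (bookkeeping lemma for
  the architecture risk: an `o(N)` localisation error PER WINDOW suffices).
* §6 DEAD ENDS (docstring `dead_ends`).
* §7 (cycle 2) THE ANTECEDENT'S ACTIVITY IS A DUMMY: `localGibbsLaw_const_activity` (constant activity cancels from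
  `canonicalDensity`), `kineticFluxLdDecay_iff_unitActivity : A ↔ A|_{a=1}`, `crux_iff_unitActivity_imp`; so A speaks of ONE
  state per `σ` (density `1`) and every use at local density `ρ` is a re-embedding at parameter `σρ^{1/3}`
  (`hsDiameter_reembed`) — the density-range bookkeeping (BN1) behind "B fixes σ₀ before the solution".
* §8 (cycle 2) THE AMPLITUDE BUDGET as limits: `cubic_budget_diverges` (bounded class: `T A³/κ − cA² → +∞`, no cut-off
  schedule closes), `quadratic_budget_closes` (quadratic class: `C T A/κ − cA² → −∞`).
* §9 (cycle 2) THE CONSEQUENT'S STATIC SHADOW: `DensityRepresentable` (B minus its entropy clause),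
  `relEntropyVanishing_imp_representable`, `crux_imp_representable_of_antecedent` — the one door to `¬B` is a
  non-representable dense excursion (crux 12586, RESISTS).
* §10 (cycle 2) NOTES ON THE TYPED CHILDREN of round 1 (docstring `notes_on_typed_children`): invariant-tilt floors
  QUANTIFIED — bounded class `κ_crit = 0.977` (reproduces the record), quadratic class `c_crit = 0.177`, rare band
  `c_crit(V₁) = 0.214 … 0.36 (V₁ = 0 … 3) ↑ 1/2` (kit j010257 + local replica); AmplitudeLadder's re-orthogonalisation gap and
  its repair; LocalKineticFluxLd / GaussianShellMoment / HighMomentumCutoff / InfluenceLocality audits.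
* §10b (cycle 2) A BRICK SETTLED: `gaussianShellMoment_holds` — ideator 3's `GaussianShellMoment` (the summable shell
  error of the Nachtergaele–Yau cut-off scheme) is PROVED.
* §11 (cycle 2) WHY IT RESISTS, addendum (`why_it_resists_c2`) and DEAD ENDS (`dead_ends_c2`).
* §12 (cycle 3) TARGETS — the picked line `explosion-limited-jamming`: STUB 2 `MesoJammedSetLd` is PHYSICALLY FALSE AS TYPED by
  PERSISTENT CONTACT LAMINATES (pressure-balanced entropy layers at scale `N^{-1/6}`: static cost `a(Λ₁)N` once — `5η²N` at level `1+η`,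
  `1.03N` at level 2 — against activity `2πσ³θβT·N`; all large `N`; survives the drefute liftability repair); quantifier skeleton
  `forall_amp_horizon_false_of_linear_floor`, repair `exists_sigma0_cap` (level floor + cap `βT ≤ K` BEFORE `σ₀`; dock: `β₁` independent of
  the accuracy), `slight_laminate_beats_any_gain`; STUB 3 necessary bound `β₀ ≲ a(Λ₁)/(σ³θ‖∇φ‖₁)`; audit deltas for STUBS 1/4/5/6.
  (L3) as theorems: `isHardSphereEulerSolution_static_isobaric` (contact laminates at rest solve hs-Euler for EVERY EOS),
  `isHardSphereEulerSolution_static_sigma_zero` (non-constant-density classical solutions certified at `σ = 0`) — proposed as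
  `Negative/StaticLaminates.lean` (p81001).
* §13 (cycle 3) WHY IT RESISTS addendum (`why_it_resists_c3`: the EOS-free class is `ρ ≡ const` + vortices/shear with `∇θ ≠ 0`; no
  EOS-free compression on `𝕋³`) and DEAD ENDS (`dead_ends_c3`).

LANDED as negative knowledge (`Theorems/KineticWindowGronwall/Negative/`, `--supports` this item, ACCEPTED 2026-08-16):
`CubicMomentDiverges.lean` (p73911, §4: `KineticWindowGronwallNegative.lintegral_exp_mul_pow_three_eq_top`),
`ConsequentLoadBearing.lean` (p74367, §2–§3: `KineticWindowGronwallNegative.relEntropyVanishingUntied_false`,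
`relEntropyVanishingNoPDE_false`, `crux_untied_false_of_antecedent`, `crux_noPDE_false_of_antecedent` + helpers) —
self-contained, importable by ideators / planners / the lead. Cycle 2 (ACCEPTED 2026-08-16): `ActivityDummy.lean`
(p75880, §7: `localGibbsLaw_const_activity`, `kineticFluxLdDecay_iff_unitActivity`, `hsDiameter_reembed`,
`crux_iff_unitActivity_imp`), `StaticShadow.lean` (p76324, §9: `DensityRepresentable`, `relEntropyVanishing_imp_representable`,
`crux_imp_representable_of_antecedent`); `GaussianShellMoment.lean` (p76858, §10b).
-/

noncomputable section

namespace Summit.AtomisticToContinuum.HydrodynamicLimit.Cruxes.KineticWindowGronwall.Disproof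

open MeasureTheory Filter Set Topology
open scoped ENNReal
open Literature.MathematicalPhysics.KineticTheory Literature.Analysis.FluidPDE
open Literature.Analysis.FunctionSpaces
open Summit.AtomisticToContinuum.HydrodynamicLimit.Theses
open Summit.AtomisticToContinuum.HydrodynamicLimit.Theses.AntiMazurCoboundaries

/-! ## §0 The shared item: one statement, two route decls -/

/-- The crux is literally the implication `KineticFluxLdDecay → RelEntropyVanishing`. -/
theorem crux_iff : KineticWindowGronwall ↔ (KineticFluxLdDecay → RelEntropyVanishing) := Iff.rfl

/-- The sibling route's decl (route FluxGibbsianityLdDrude, same item 9282) is the same term. -/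
theorem crux_eq_sibling :
    AntiMazurCoboundaries.KineticWindowGronwall = FluxGibbsianityLdDrude.KineticWindowGronwall := rfl

/-- … and so are antecedent and consequent (items 10967 and 0766 are shared verbatim). -/
theorem antecedent_eq_sibling :
    AntiMazurCoboundaries.KineticFluxLdDecay = FluxGibbsianityLdDrude.KineticFluxLdDecay := rfl

theorem consequent_eq_sibling :
    AntiMazurCoboundaries.RelEntropyVanishing = FluxGibbsianityLdDrude.RelEntropyVanishing := rfl

/-! ## §1 Logical normal form of a disproof -/

/-- **What a kill of this crux is.** `¬ KineticWindowGronwall ↔ KineticFluxLdDecay ∧ ¬ RelEntropyVanishing`: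
any refutation proves the open LD input A outright AND refutes the Yau-form target B. -/
theorem not_crux_iff : ¬ KineticWindowGronwall ↔ (KineticFluxLdDecay ∧ ¬ RelEntropyVanishing) := by
  rw [crux_iff, Classical.not_imp]

/-- The crux follows from its consequent alone (so it is at most as hard as the target 0766 …). -/
theorem crux_of_consequent (hB : RelEntropyVanishing) : KineticWindowGronwall := fun _ => hB

/-- … and holds vacuously if the antecedent (shared crux 10967) is false — the route is then dead by its own
kill criterion, but THIS item would close `proved`. -/
theorem crux_of_not_antecedent (hA : ¬ KineticFluxLdDecay) : KineticWindowGronwall := fun h => (hA h).elim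

/-- Given the antecedent, the crux IS the target. -/
theorem crux_iff_consequent_of_antecedent (hA : KineticFluxLdDecay) :
    KineticWindowGronwall ↔ RelEntropyVanishing :=
  ⟨fun h => h hA, fun hB _ => hB⟩

/-! ## §2 The `t = 0` tie of the consequent is load-bearing -/

/-- `RelEntropyVanishing` with the `t = 0` law-of-large-numbers TIE
`TendstoHydroFieldsAt (fun N => localGibbsLaw σ a₀ u₀ θ₀ N (Φ N)) Φ ρ u θ 0 →` DELETED (all else verbatim):
the Euler solution is then untied from the local Gibbs data. -/
def RelEntropyVanishingUntied : Prop :=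
  ∀ (a₀ θ₀ : T3 → ℝ) (u₀ : T3 → V3), Continuous a₀ → Continuous θ₀ → Continuous u₀ → (∀ x, 0 < a₀ x) →
    (∀ x, 0 < θ₀ x) → ∃ σ₀ : ℝ, 0 < σ₀ ∧ ∀ σ : ℝ, 0 < σ → σ < σ₀ →
    ∀ (T : ℝ) (ρ θ : ℝ → T3 → ℝ) (u : ℝ → T3 → V3), IsHardSphereEulerSolution σ T ρ u θ →
    ∀ Φ : (N : ℕ) → HardSphereFlow (Torus.geometry (Fin 3)) (hsDiameter σ N) (N + 1),
      (∀ N, IsProbabilityMeasure (localGibbsLaw σ a₀ u₀ θ₀ N (Φ N))) ∧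
      (∀ t ∈ Set.Ico 0 T, ∃ a : T3 → ℝ,
        (∀ N, IsProbabilityMeasure (localGibbsLaw σ a (u t) (θ t) N (Φ N))) ∧
        (∀ χ : T3 → ℝ, Continuous χ → ∀ δ : ℝ, 0 < δ → ∃ C : ℝ, 0 < C ∧ ∀ N : ℕ,
          localGibbsLaw σ a (u t) (θ t) N (Φ N)
              {z | δ < |empiricalDensityField z χ - ∫ x, χ x * ρ t x|} ≤
            ENNReal.ofReal (C * Real.exp (-(C⁻¹ * (N + 1)))) ∧
          localGibbsLaw σ a (u t) (θ t) N (Φ N)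
              {z | δ < ‖empiricalMomentumField z χ - ∫ x, (χ x * ρ t x) • u t x‖} ≤
            ENNReal.ofReal (C * Real.exp (-(C⁻¹ * (N + 1)))) ∧
          localGibbsLaw σ a (u t) (θ t) N (Φ N)
              {z | δ < |empiricalEnergyField z χ -
                ∫ x, χ x * totalEnergyDensity (ρ t x) (u t x) (θ t x)|} ≤
            ENNReal.ofReal (C * Real.exp (-(C⁻¹ * (N + 1))))) ∧
        Tendsto (fun N : ℕ => InformationTheory.klDiv
            ((Φ N).lawAt (localGibbsLaw σ a₀ u₀ θ₀ N (Φ N)) t) (localGibbsLaw σ a (u t) (θ t) N (Φ N)) /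
          ((N : ℝ≥0∞) + 1)) atTop (nhds 0))

/-- A family of hard-sphere flows (one per particle number) at reduced density `σ`. -/
abbrev Flows (σ : ℝ) := (N : ℕ) → HardSphereFlow (Torus.geometry (Fin 3)) (hsDiameter σ N) (N + 1)

/-- Flow families exist for `0 < σ < 1/2` (Alexander's theorem on `𝕋³`, PROVED in the tree:
`HardSphereFlow.nonempty_torus_holds`; `hsDiameter σ N ≤ σ`). [folklore] -/
theorem flows_nonempty {σ : ℝ} (hσ : 0 < σ) (hσ2 : σ < 1 / 2) : Nonempty (Flows σ) :=
  ⟨fun N => Classical.choice (HardSphereFlow.nonempty_torus_holds (d := Fin 3)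
    (hsDiameter_pos hσ N) ((hsDiameter_le hσ.le N).trans_lt (hσ2.trans_eq (by norm_num))) (N + 1))⟩

/-- Constant states are classical hard-sphere-Euler solutions, for every `σ`, `T` and density level
(all derivatives vanish, whatever the equation of state). [folklore] -/
theorem isHardSphereEulerSolution_const (σ T : ℝ) {ρ₀ θ₀ : ℝ} (u₀ : V3) (hρ : 0 < ρ₀) (hθ : 0 < θ₀) :
    IsHardSphereEulerSolution σ T (fun _ _ => ρ₀) (fun _ _ => u₀) (fun _ _ => θ₀) :=
  isHardSphereEulerSolutionDim_three_iff.1 (IsHardSphereEulerSolutionDim.const σ T u₀ hρ hθ)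

/-- `C · exp(-(N+1)/C) < 1` for some `N` (the exponential concentration bound eventually beats a
probability-one event). [folklore] -/
theorem exists_conc_bound_lt_one {C : ℝ} (hC : 0 < C) : ∃ N : ℕ, C * Real.exp (-(C⁻¹ * (N + 1))) < 1 := by
  have h1 : Tendsto (fun N : ℕ => C⁻¹ * ((N : ℝ) + 1)) atTop atTop :=
    (tendsto_atTop_add_const_right _ 1 tendsto_natCast_atTop_atTop).const_mul_atTop (inv_pos.2 hC)
  have h2 : Tendsto (fun N : ℕ => C * Real.exp (-(C⁻¹ * ((N : ℝ) + 1)))) atTop (nhds (C * 0)) :=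
    (Real.tendsto_exp_atBot.comp (tendsto_neg_atTop_atBot.comp h1)).const_mul C
  rw [mul_zero] at h2
  exact (h2.eventually (gt_mem_nhds one_pos)).exists

/-- The deviation event of the empirical density of `χ ≡ 1` from a field of mass `m ≠ 1` is EVERYTHING once
`δ < |1 - m|` (the empirical density of `1` is identically `1`). [folklore] -/
theorem devSet_one_eq_univ {N : ℕ} {r : T3 → ℝ} {δ : ℝ} (hδ : δ < |1 - ∫ x, r x|) :
    {z : Config (N + 1) (Fin 3) T3 | δ < |empiricalDensityField z (fun _ => 1) - ∫ x, (fun _ => (1 : ℝ)) x * r x|}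
      = univ := by
  ext z
  simp only [mem_setOf_eq, mem_univ, iff_true, empiricalDensityField_one (Nat.succ_ne_zero N), one_mul]
  exact hδ

/-- **The tie is load-bearing: `RelEntropyVanishingUntied` is FALSE.** Witness: profiles `(1, 0, 1)`; for the
offered `σ₀` take `σ = min(σ₀/2, 1/4)`; the constant classical solution `(2, 0, 1)` on `[0, 1)`; any flow family
(Alexander). At `t = 0` the concentration clause with `χ ≡ 1`, `δ = 1/2` bounds the measure of the WHOLE space
(`|1 - 2| = 1 > 1/2`) by `C e^{-(N+1)/C} < 1` for large `N`, against total mass `1` of the reference law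
(its own clause (i)). [folklore] -/
theorem relEntropyVanishingUntied_false : ¬ RelEntropyVanishingUntied := by
  intro h
  obtain ⟨σ₀, hσ₀, H⟩ := h (fun _ => 1) (fun _ => 1) (fun _ => 0) continuous_const continuous_const
    continuous_const (fun _ => one_pos) (fun _ => one_pos)
  set σ : ℝ := min (σ₀ / 2) (1 / 4) with hσdef
  have hσ : 0 < σ := lt_min (by positivity) (by norm_num)
  have hσlt : σ < σ₀ := (min_le_left _ _).trans_lt (by linarith)
  have hσ2 : σ < 1 / 2 := (min_le_right _ _).trans_lt (by norm_num)
  obtain ⟨Φ⟩ := flows_nonempty hσ hσ2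
  have hE := isHardSphereEulerSolution_const σ 1 (0 : V3) (by norm_num : (0 : ℝ) < 2) one_pos
  obtain ⟨-, H2⟩ := H σ hσ hσlt 1 (fun _ _ => 2) (fun _ _ => 1) (fun _ _ => 0) hE Φ
  obtain ⟨a, hPa, hconc, -⟩ := H2 0 ⟨le_rfl, one_pos⟩
  obtain ⟨C, hC, hN⟩ := hconc (fun _ => 1) continuous_const (1 / 2) (by norm_num)
  obtain ⟨N, hNlt⟩ := exists_conc_bound_lt_one hC
  have hmass : ∫ x : T3, (2 : ℝ) = 2 := by simp
  have hδ : (1 / 2 : ℝ) < |1 - ∫ x : T3, (2 : ℝ)| := by rw [hmass]; norm_num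
  have h1 := (hN N).1
  rw [devSet_one_eq_univ hδ, measure_univ] at h1
  have : (1 : ℝ≥0∞) < 1 :=
    h1.trans_lt (by
      rw [← ENNReal.ofReal_one]
      exact (ENNReal.ofReal_lt_ofReal_iff one_pos).2 (by exact_mod_cast hNlt))
  exact lt_irrefl _ this

/-- Hence NO proof of the crux survives deletion of the tie: given the antecedent, the untied implication
is false. [folklore] -/
theorem crux_untied_false_of_antecedent (hA : KineticFluxLdDecay) :
    ¬ (KineticFluxLdDecay → RelEntropyVanishingUntied) :=
  fun h => relEntropyVanishingUntied_false (h hA)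


/-- The generic contradiction behind §2–§3: under probability laws, an exponential concentration bound for the
empirical density of `χ ≡ 1` around a field `r` of mass `≠ 1` is impossible (the deviation event is everything
once `δ < |1 - ∫ r|`). [folklore] -/
theorem false_of_expConc_mass_ne {σ : ℝ} {a ϑ r : T3 → ℝ} {v : T3 → V3} (Φ : Flows σ)
    (hPa : ∀ N, IsProbabilityMeasure (localGibbsLaw σ a v ϑ N (Φ N))) {δ C : ℝ}
    (hδ : δ < |1 - ∫ x, r x|) (hC : 0 < C)
    (hN : ∀ N : ℕ, localGibbsLaw σ a v ϑ N (Φ N)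
      {z | δ < |empiricalDensityField z (fun _ => 1) - ∫ x, (fun _ => (1 : ℝ)) x * r x|} ≤
        ENNReal.ofReal (C * Real.exp (-(C⁻¹ * (N + 1))))) : False := by
  obtain ⟨N, hNlt⟩ := exists_conc_bound_lt_one hC
  have h1 := hN N
  rw [devSet_one_eq_univ hδ, measure_univ] at h1
  have : (1 : ℝ≥0∞) < 1 :=
    h1.trans_lt (by
      rw [← ENNReal.ofReal_one]
      exact (ENNReal.ofReal_lt_ofReal_iff one_pos).2 (by exact_mod_cast hNlt))
  exact lt_irrefl _ this

/-! ## §3 The Euler balance laws of the consequent are load-bearing -/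

/-- `RelEntropyVanishing` with `IsHardSphereEulerSolution σ T ρ u θ` WEAKENED to its regularity-and-positivity
part (joint smoothness of `ρ, u, θ` on `[0,T) × 𝕋³`, `ρ, θ > 0`; the three balance laws deleted; all else —
including the `t = 0` tie — verbatim). -/
def RelEntropyVanishingNoPDE : Prop :=
  ∀ (a₀ θ₀ : T3 → ℝ) (u₀ : T3 → V3), Continuous a₀ → Continuous θ₀ → Continuous u₀ → (∀ x, 0 < a₀ x) →
    (∀ x, 0 < θ₀ x) → ∃ σ₀ : ℝ, 0 < σ₀ ∧ ∀ σ : ℝ, 0 < σ → σ < σ₀ →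
    ∀ (T : ℝ) (ρ θ : ℝ → T3 → ℝ) (u : ℝ → T3 → V3),
      Torus.IsSmoothSpaceTimeOn (Set.Ico 0 T) ρ → Torus.IsSmoothSpaceTimeOn (Set.Ico 0 T) u →
      Torus.IsSmoothSpaceTimeOn (Set.Ico 0 T) θ → (∀ t ∈ Set.Ico 0 T, ∀ x, 0 < ρ t x) →
      (∀ t ∈ Set.Ico 0 T, ∀ x, 0 < θ t x) →
    ∀ Φ : (N : ℕ) → HardSphereFlow (Torus.geometry (Fin 3)) (hsDiameter σ N) (N + 1),
      (∀ N, IsProbabilityMeasure (localGibbsLaw σ a₀ u₀ θ₀ N (Φ N))) ∧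
      (TendstoHydroFieldsAt (fun N => localGibbsLaw σ a₀ u₀ θ₀ N (Φ N)) Φ ρ u θ 0 →
       ∀ t ∈ Set.Ico 0 T, ∃ a : T3 → ℝ,
        (∀ N, IsProbabilityMeasure (localGibbsLaw σ a (u t) (θ t) N (Φ N))) ∧
        (∀ χ : T3 → ℝ, Continuous χ → ∀ δ : ℝ, 0 < δ → ∃ C : ℝ, 0 < C ∧ ∀ N : ℕ,
          localGibbsLaw σ a (u t) (θ t) N (Φ N)
              {z | δ < |empiricalDensityField z χ - ∫ x, χ x * ρ t x|} ≤
            ENNReal.ofReal (C * Real.exp (-(C⁻¹ * (N + 1)))) ∧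
          localGibbsLaw σ a (u t) (θ t) N (Φ N)
              {z | δ < ‖empiricalMomentumField z χ - ∫ x, (χ x * ρ t x) • u t x‖} ≤
            ENNReal.ofReal (C * Real.exp (-(C⁻¹ * (N + 1)))) ∧
          localGibbsLaw σ a (u t) (θ t) N (Φ N)
              {z | δ < |empiricalEnergyField z χ -
                ∫ x, χ x * totalEnergyDensity (ρ t x) (u t x) (θ t x)|} ≤
            ENNReal.ofReal (C * Real.exp (-(C⁻¹ * (N + 1))))) ∧
        Tendsto (fun N : ℕ => InformationTheory.klDiv
            ((Φ N).lawAt (localGibbsLaw σ a₀ u₀ θ₀ N (Φ N)) t) (localGibbsLaw σ a (u t) (θ t) N (Φ N)) /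
          ((N : ℝ≥0∞) + 1)) atTop (nhds 0))

/-- `TendstoHydroFieldsAt … t` only sees the time-`t` slices of the fields. [folklore] -/
theorem tendstoHydroFieldsAt_congr_slices {ε : ℕ → ℝ} {P : (N : ℕ) → Measure (Config (N + 1) (Fin 3) T3)}
    {Φ : (N : ℕ) → HardSphereFlow (Torus.geometry (Fin 3)) (ε N) (N + 1)}
    {ρ ρ' θ θ' : ℝ → T3 → ℝ} {u u' : ℝ → T3 → V3} {t : ℝ}
    (h1 : ρ t = ρ' t) (h2 : u t = u' t) (h3 : θ t = θ' t) :
    TendstoHydroFieldsAt P Φ ρ u θ t ↔ TendstoHydroFieldsAt P Φ ρ' u' θ' t := by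
  unfold TendstoHydroFieldsAt
  rw [h1, h2, h3]

/-- The non-conservative smooth test density `ρ(t, x) = 1 + t` (mass `1 + t`). -/
def ramp : ℝ → T3 → ℝ := fun t _ => 1 + t

/-- The ramp starts at the uniform density `1`. [folklore] -/
theorem ramp_zero : ramp 0 = fun _ => 1 := funext fun _ => by simp [ramp]

/-- The ramp is jointly smooth (its space–time lift is `(t, y) ↦ 1 + t`). [folklore] -/
theorem isSmoothSpaceTimeOn_ramp (S : Set ℝ) : Torus.IsSmoothSpaceTimeOn S ramp :=
  Torus.isSmoothSpaceTimeOn_of_contDiff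
    (show ContDiff ℝ _ (fun p : ℝ × EuclideanSpace ℝ (Fin 3) => 1 + p.1) from
      contDiff_const.add contDiff_fst) S

/-- For the UNIFORM activity the pinned LLN density `rhoLim (profileOf 1) σ` is the constant `1` (it is constant
in `x` since `β ≡ 1`, and has unit mass under `SmallDensity`). [folklore] -/
theorem rhoLim_uniform_eq_one {σ : ℝ}
    (h : SmallDensity (profileOf (fun _ : T3 => (1 : ℝ)) continuous_const (fun _ => one_pos)) σ) :
    rhoLim (profileOf (fun _ : T3 => (1 : ℝ)) continuous_const (fun _ => one_pos)) σ = fun _ => 1 := by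
  set P := profileOf (fun _ : T3 => (1 : ℝ)) continuous_const (fun _ => one_pos) with hP
  have hconst : ∀ x y : T3, rhoLim P σ x = rhoLim P σ y := fun x y => by
    simp only [hP, rhoLim, profileOf_β]
  funext x
  have h1 := Summit.AtomisticToContinuum.HydrodynamicLimit.Theorems.PolynomialCompressionStatics.integral_rhoLim_eq_one h
  have h2 : ∫ y, rhoLim P σ y = ∫ _ : T3, rhoLim P σ x := integral_congr_ae (Eventually.of_forall fun y => hconst y x)
  rw [h2] at h1
  simpa using h1

/-- **The balance laws are load-bearing: `RelEntropyVanishingNoPDE` is FALSE.** Witness: profiles `(1, 0, 1)`;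
`σ` below the offered `σ₀` and below the tree's LLN threshold `σ₁` (`PolynomialCompressionPDE.lln_rhoLim`, built on
the PROVED `localGibbs_lln_holds`; pinned density `rhoLim ≡ 1` for the uniform activity); the smooth positive fields
`(1 + t, 0, 1)` on `[0, 1)` ARE tied at `t = 0` but have mass `3/2` at `t = 1/2`, so no activity `a` gives the
exponential concentration of the empirical density of `χ ≡ 1` (identically `1`). [folklore] -/
theorem relEntropyVanishingNoPDE_false : ¬ RelEntropyVanishingNoPDE := by
  intro h
  obtain ⟨σ₀, hσ₀, H⟩ := h (fun _ => 1) (fun _ => 1) (fun _ => 0) continuous_const continuous_const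
    continuous_const (fun _ => one_pos) (fun _ => one_pos)
  obtain ⟨σ₁, hσ₁, hσ₁h, L⟩ :=
    Summit.AtomisticToContinuum.HydrodynamicLimit.Theorems.PolynomialCompressionPDE.lln_rhoLim
      (a₀ := fun _ : T3 => (1 : ℝ)) (θ₀ := fun _ => (1 : ℝ)) (u₀ := fun _ => (0 : V3))
      continuous_const continuous_const continuous_const (fun _ => one_pos) (fun _ => one_pos)
  set σ : ℝ := min (σ₀ / 2) (σ₁ / 2) with hσdef
  have hσ : 0 < σ := lt_min (by positivity) (by positivity)
  have hσlt : σ < σ₀ := (min_le_left _ _).trans_lt (by linarith)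
  have hσlt1 : σ < σ₁ := (min_le_right _ _).trans_lt (by linarith)
  have hσ2 : σ < 1 / 2 := hσlt1.trans_le hσ₁h
  obtain ⟨Φ⟩ := flows_nonempty hσ hσ2
  obtain ⟨hsd, -, hL⟩ := L σ hσ hσlt1
  obtain ⟨-, htie⟩ := hL Φ
  have hpos1 : ∀ t ∈ Set.Ico (0 : ℝ) 1, ∀ x : T3, 0 < ramp t x := fun t ht x => by
    simp only [ramp]; linarith [ht.1]
  have hpos2 : ∀ t ∈ Set.Ico (0 : ℝ) 1, ∀ _x : T3, (0 : ℝ) < 1 := fun _ _ _ => one_pos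
  obtain ⟨-, H2⟩ := H σ hσ hσlt 1 ramp (fun _ _ => 1) (fun _ _ => 0) (isSmoothSpaceTimeOn_ramp _)
    (Torus.isSmoothSpaceTimeOn_of_contDiff contDiff_const _)
    (Torus.isSmoothSpaceTimeOn_of_contDiff contDiff_const _) hpos1 hpos2 Φ
  have htie' : TendstoHydroFieldsAt (fun N => localGibbsLaw σ (fun _ => 1) (fun _ => 0) (fun _ => 1) N (Φ N)) Φ
      ramp (fun _ _ => 0) (fun _ _ => 1) 0 := by
    refine (tendstoHydroFieldsAt_congr_slices (ρ' := fun _ => rhoLim (profileOf (fun _ : T3 => (1 : ℝ))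
      continuous_const (fun _ => one_pos)) σ) (u' := fun _ _ => 0) (θ' := fun _ _ => 1) ?_ rfl rfl).2 htie
    rw [ramp_zero, rhoLim_uniform_eq_one hsd]
  obtain ⟨a, hPa, hconc, -⟩ := H2 htie' (1 / 2) ⟨by norm_num, by norm_num⟩
  obtain ⟨C, hC, hN⟩ := hconc (fun _ => 1) continuous_const (1 / 4) (by norm_num)
  have hmass : ∫ x : T3, ramp (1 / 2) x = 3 / 2 := by simp [ramp]; norm_num
  have hδ : (1 / 4 : ℝ) < |1 - ∫ x : T3, ramp (1 / 2) x| := by rw [hmass]; norm_num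
  exact false_of_expConc_mass_ne Φ hPa hδ hC fun N => (hN N).1

/-- Hence, given the antecedent, the crux with the balance laws deleted from its consequent is false: a proof
must integrate the Euler equations (at least mass conservation) along the reference solution. [folklore] -/
theorem crux_noPDE_false_of_antecedent (hA : KineticFluxLdDecay) :
    ¬ (KineticFluxLdDecay → RelEntropyVanishingNoPDE) :=
  fun h => relEntropyVanishingNoPDE_false (h hA)

/-! ## §4 The method obstruction, made checkable: cubic exponential moments of a Maxwellian diverge -/

/-- **No Maxwellian has a finite exponential CUBIC moment**: `∫ exp(α x³) dγ(x) = ∞` for every `α > 0`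
(`γ` the standard Gaussian on `ℝ`; by scaling the same holds for every centred or drifted Maxwellian of any
temperature, and — one component at a time, `v₁|v|² ≥ v₁³` on `v₁ ≥ 0` — for the one-body symbol `v|v|²/2` of
the ENERGY CURRENT in `ℝ³`). Consequence for the informal proof plan of the crux: the entropy inequality
`∫ X df ≤ β⁻¹ [H(f|ψ) + log ∫ e^{βX} dψ]` is VOID (`+∞` on the right) for the energy-current term and for the
cubic velocity tail `Σᵢ |vᵢ|³ 1(|vᵢ| > A)` under EVERY local Gibbs reference `ψ`; the "tail by a truncation
statement under f_t (GIVEN)" of the plan is therefore an a-priori estimate on the TRUE law that the entropy method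
cannot supply (`Literature.Barriers.AtomisticToContinuum.HighMomentumCutoff`, OVY 1993 p. 525: bounded-gradient
kinetic energy; Nachtergaele–Yau 2003 Assumption II.1: "no proof even in the classical case"). [folklore] -/
theorem lintegral_exp_mul_pow_three_eq_top {α : ℝ} (hα : 0 < α) :
    ∫⁻ x, ENNReal.ofReal (Real.exp (α * x ^ 3)) ∂(ProbabilityTheory.gaussianReal 0 1) = ∞ := by
  rw [ProbabilityTheory.gaussianReal_of_var_ne_zero 0 one_ne_zero,
    lintegral_withDensity_eq_lintegral_mul _ (ProbabilityTheory.measurable_gaussianPDF 0 1)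
      (by fun_prop : Measurable fun x : ℝ => ENNReal.ofReal (Real.exp (α * x ^ 3)))]
  -- on `[R, ∞)`, `R = (2α)⁻¹`, the integrand is at least the constant `(√(2π))⁻¹`
  set R : ℝ := (2 * α)⁻¹ with hR
  have hRpos : 0 < R := by positivity
  set c : ℝ≥0∞ := ENNReal.ofReal ((Real.sqrt (2 * Real.pi))⁻¹) with hc
  have hcpos : c ≠ 0 := by
    rw [hc]; exact (ENNReal.ofReal_pos.2 (inv_pos.2 (Real.sqrt_pos.2 (by positivity)))).ne'
  have hpt : ∀ x ∈ Set.Ici R, c ≤ (ProbabilityTheory.gaussianPDF 0 1 * fun x => ENNReal.ofReal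
      (Real.exp (α * x ^ 3))) x := by
    intro x hx
    have hx0 : 0 < x := hRpos.trans_le hx
    simp only [Pi.mul_apply, ProbabilityTheory.gaussianPDF, ProbabilityTheory.gaussianPDFReal]
    rw [← ENNReal.ofReal_mul (by positivity)]
    refine ENNReal.ofReal_le_ofReal ?_
    have hsqrt : Real.sqrt (2 * Real.pi * ((1 : NNReal) : ℝ)) = Real.sqrt (2 * Real.pi) := by
      rw [NNReal.coe_one, mul_one]
    rw [hsqrt, mul_assoc, ← Real.exp_add]
    have hexp : (0 : ℝ) ≤ -(x - 0) ^ 2 / (2 * ((1 : NNReal) : ℝ)) + α * x ^ 3 := by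
      rw [NNReal.coe_one, mul_one, sub_zero]
      have hαx : 1 / 2 ≤ α * x := by
        have : (2 * α)⁻¹ ≤ x := hx
        rw [inv_le_iff_one_le_mul₀ (by positivity)] at this
        linarith
      have hx2 : 0 ≤ x ^ 2 := sq_nonneg x
      nlinarith
    have h1 : (1 : ℝ) ≤ Real.exp (-(x - 0) ^ 2 / (2 * ((1 : NNReal) : ℝ)) + α * x ^ 3) :=
      Real.one_le_exp hexp
    have hs : 0 < (Real.sqrt (2 * Real.pi))⁻¹ := inv_pos.2 (Real.sqrt_pos.2 (by positivity))
    nlinarith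
  refine eq_top_iff.2 ?_
  calc (⊤ : ℝ≥0∞) = c * volume (Set.Ici R) := by rw [Real.volume_Ici, ENNReal.mul_top hcpos]
    _ = ∫⁻ _ in Set.Ici R, c ∂(volume : Measure ℝ) := (setLIntegral_const _ _).symm
    _ ≤ ∫⁻ x in Set.Ici R, (ProbabilityTheory.gaussianPDF 0 1 * fun x => ENNReal.ofReal
        (Real.exp (α * x ^ 3))) x ∂volume := setLIntegral_mono' measurableSet_Ici hpt
    _ ≤ _ := setLIntegral_le_lintegral _ _


/-! ## §4b On constant tied data the consequent has NO dynamical content (vacuity map) -/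

/-- The body of `RelEntropyVanishing` after `∀ Φ` (its conclusion for given profiles, `σ`, horizon, fields and
flows); `relEntropyVanishing_iff_consequentAt` certifies the transcription by `Iff.rfl`. -/
def ConsequentAt (σ : ℝ) (a₀ θ₀ : T3 → ℝ) (u₀ : T3 → V3) (T : ℝ) (ρ θ : ℝ → T3 → ℝ) (u : ℝ → T3 → V3)
    (Φ : Flows σ) : Prop :=
  (∀ N, IsProbabilityMeasure (localGibbsLaw σ a₀ u₀ θ₀ N (Φ N))) ∧
  (TendstoHydroFieldsAt (fun N => localGibbsLaw σ a₀ u₀ θ₀ N (Φ N)) Φ ρ u θ 0 →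
    ∀ t ∈ Set.Ico 0 T, ∃ a : T3 → ℝ,
      (∀ N, IsProbabilityMeasure (localGibbsLaw σ a (u t) (θ t) N (Φ N))) ∧
      (∀ χ : T3 → ℝ, Continuous χ → ∀ δ : ℝ, 0 < δ → ∃ C : ℝ, 0 < C ∧ ∀ N : ℕ,
        localGibbsLaw σ a (u t) (θ t) N (Φ N)
            {z | δ < |empiricalDensityField z χ - ∫ x, χ x * ρ t x|} ≤
          ENNReal.ofReal (C * Real.exp (-(C⁻¹ * (N + 1)))) ∧
        localGibbsLaw σ a (u t) (θ t) N (Φ N)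
            {z | δ < ‖empiricalMomentumField z χ - ∫ x, (χ x * ρ t x) • u t x‖} ≤
          ENNReal.ofReal (C * Real.exp (-(C⁻¹ * (N + 1)))) ∧
        localGibbsLaw σ a (u t) (θ t) N (Φ N)
            {z | δ < |empiricalEnergyField z χ -
              ∫ x, χ x * totalEnergyDensity (ρ t x) (u t x) (θ t x)|} ≤
          ENNReal.ofReal (C * Real.exp (-(C⁻¹ * (N + 1))))) ∧
      Tendsto (fun N : ℕ => InformationTheory.klDiv
          ((Φ N).lawAt (localGibbsLaw σ a₀ u₀ θ₀ N (Φ N)) t) (localGibbsLaw σ a (u t) (θ t) N (Φ N)) /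
        ((N : ℝ≥0∞) + 1)) atTop (nhds 0))

/-- The transcription is faithful. -/
theorem relEntropyVanishing_iff_consequentAt :
    RelEntropyVanishing ↔ ∀ (a₀ θ₀ : T3 → ℝ) (u₀ : T3 → V3), Continuous a₀ → Continuous θ₀ → Continuous u₀ →
      (∀ x, 0 < a₀ x) → (∀ x, 0 < θ₀ x) → ∃ σ₀ : ℝ, 0 < σ₀ ∧ ∀ σ : ℝ, 0 < σ → σ < σ₀ →
      ∀ (T : ℝ) (ρ θ : ℝ → T3 → ℝ) (u : ℝ → T3 → V3), IsHardSphereEulerSolution σ T ρ u θ →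
      ∀ Φ : Flows σ, ConsequentAt σ a₀ θ₀ u₀ T ρ θ u Φ :=
  Iff.rfl

/-- EXPONENTIAL CONCENTRATION of the three empirical fields of the HOMOGENEOUS Gibbs laws
`G_N = localGibbsLaw σ 1 u_c θ_c` around `(1, u_c, θ_c)`: the constant-profile instance of the shared static
item LocalGibbsConcentration (0767/9246) with its density identified (`rhoLim ≡ 1`, §3). OPEN (low-density
cluster expansion at large-deviation precision); asserted nowhere, used only as a hypothesis below. -/
def HomogeneousExpConcentration (σ θc : ℝ) (uc : V3) : Prop :=
  ∀ (Φ : Flows σ) (χ : T3 → ℝ), Continuous χ → ∀ δ : ℝ, 0 < δ → ∃ C : ℝ, 0 < C ∧ ∀ N : ℕ,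
    localGibbsLaw σ (fun _ => 1) (fun _ => uc) (fun _ => θc) N (Φ N)
        {z | δ < |empiricalDensityField z χ - ∫ x, χ x * 1|} ≤
      ENNReal.ofReal (C * Real.exp (-(C⁻¹ * (N + 1)))) ∧
    localGibbsLaw σ (fun _ => 1) (fun _ => uc) (fun _ => θc) N (Φ N)
        {z | δ < ‖empiricalMomentumField z χ - ∫ x, (χ x * 1) • uc‖} ≤
      ENNReal.ofReal (C * Real.exp (-(C⁻¹ * (N + 1)))) ∧
    localGibbsLaw σ (fun _ => 1) (fun _ => uc) (fun _ => θc) N (Φ N)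
        {z | δ < |empiricalEnergyField z χ - ∫ x, χ x * totalEnergyDensity 1 uc θc|} ≤
      ENNReal.ofReal (C * Real.exp (-(C⁻¹ * (N + 1))))

/-- **On constant tied data, B is STATICS.** For the uniform profiles `(1, θ_c, u_c)` and the constant classical
solution `(1, u_c, θ_c)` (the tied one: `rhoLim ≡ 1`), B's conclusion holds for EVERY flow family and EVERY horizon
as soon as the homogeneous Gibbs laws concentrate exponentially — with reference activity `a ≡ 1` the entropy term
is identically `0` (`(Φ_t)_# G_N = G_N`, tree: `map_flow_localGibbsLaw_const`; `klDiv_self`). No dynamics and NO USE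
OF THE ANTECEDENT A: on the exhibitable class the crux carries no information a refuter could exploit. [folklore] -/
theorem consequentAt_const_of_concentration {σ θc : ℝ} {uc : V3} (hθ : 0 < θc) (hσ2 : σ ≤ 1 / 2)
    (hconc : HomogeneousExpConcentration σ θc uc) (T : ℝ) (Φ : Flows σ) :
    ConsequentAt σ (fun _ => 1) (fun _ => θc) (fun _ => uc) T (fun _ _ => 1) (fun _ _ => θc) (fun _ _ => uc) Φ := by
  have hP : ∀ N, IsProbabilityMeasure (localGibbsLaw σ (fun _ => 1) (fun _ => uc) (fun _ => θc) N (Φ N)) :=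
    fun N => isProbabilityMeasure_localGibbsLaw continuous_const continuous_const continuous_const
      (fun _ => one_pos) (fun _ => hθ) hσ2 N (Φ N)
  refine ⟨hP, fun _ t _ => ⟨fun _ => 1, hP, fun χ hχ δ hδ => hconc Φ χ hχ δ hδ, ?_⟩⟩
  have hkl : ∀ N : ℕ, InformationTheory.klDiv
      ((Φ N).lawAt (localGibbsLaw σ (fun _ => 1) (fun _ => uc) (fun _ => θc) N (Φ N)) t)
      (localGibbsLaw σ (fun _ => 1) (fun _ => uc) (fun _ => θc) N (Φ N)) = 0 := fun N => by
    rw [HardSphereFlow.lawAt_eq,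
      Summit.AtomisticToContinuum.HydrodynamicLimit.Theorems.map_flow_localGibbsLaw_const σ 1 θc uc N (Φ N) t,
      InformationTheory.klDiv_self]
  simp only [hkl, ENNReal.zero_div]
  exact tendsto_const_nhds

/-! ## §5 Why it resists (cycle 1) -/

/-- **WHY IT RESISTS** (cycle 1, 2026-08-16; refuter-cdisprove-stmt-AtomisticToContinuum-9282-0).

1. SHAPE. `¬crux ↔ A ∧ ¬B` (§1), `A = KineticFluxLdDecay` (shared crux 10967), `B = RelEntropyVanishing`
   (shared target 0766). A kill PROVES A and REFUTES B; nothing else about the item is attackable.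
2. A IS HONEST AND OPEN. Junk audit: the window integral `∫₀ʰ F(Φ_s z) ds` is a genuine interval integral on the
   good set (orbits right-continuous with finitely many collisions on `[0,h]`, `F` bounded continuous), and the good
   set is conull under `G_N ≪ Liouville`; the `lintegral` integrand is jointly measurable (gen-1 evidence
   FlowJointMeasurability on 10967); the probability clause `∀ N Φ, IsProbabilityMeasure G_N` is a THEOREM for
   `σ ≤ 1/2` (`isProbabilityMeasure_localGibbsLaw`); the bound `e^{δ(N+1)}` is NOT implied by `|F| ≤ κ(N+1)` since
   `κ` is fixed before `δ`; earlier refuters certified A consistent (energy-shell floor `κ < 0.977`). There is no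
   proof technology for LD decay at FIXED `σ` (BGSS: horizons `o((log|log ε|)^{1/4})` in the Boltzmann–Grad limit
   only). Hence NO UNCONDITIONAL KILL of the crux is possible in this cycle, whatever B does; and every
   implication-shaped weakening `A → B'` is refutable only modulo A (§2–§3 are stated that way).
3. B IS HONEST AND NOT REFUTABLE ON EXHIBITABLE DATA. Flows (Alexander, `HardSphereFlow.nonempty_torus_holds`) and
   the `t = 0` LLN (`localGibbs_lln_holds`) are PROVED, so every hypothesis of B can be instantiated; but the only
   classical hs-Euler solutions that can be written down without evaluating the equation of state
   `Z = hsCompressibility = 1 + η·deriv(limsup(-N⁻¹ log hsFreeVolume))` (unevaluable on `(0, 512)` in the tree) are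
   the CONSTANT states and the steady PARALLEL SHEAR flows (`ρ, θ` constant, `u = (f(x₂,x₃), 0, 0)`: every term of
   the three balance laws vanishes identically, for any `Z`); tied data force `ρ ≡ rhoLim ≡ 1` for uniform
   activity (§3). On these B is PHYSICALLY TRUE at Euler scaling: the homogeneous Gibbs law is flow-invariant
   (`klDiv = 0` with `a = a₀`); for shear the viscous entropy production is `≍ N·ν·t` with `ν ≍ N^{-1/3}`
   macroscopically, `o(N)`; what remains of B there is the EXPONENTIAL LLN for (sheared) homogeneous Gibbs states
   (LocalGibbsConcentration 0767/9246, an open M-item: low-density cluster expansion at LD precision) — unproved,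
   not refutable. The junk branch of the EOS (`Z = 1` beyond packing `512`, tree-proved in
   `EnskogAdjointDualityAdjointEnskogTestFamilyRefutation`) is unreachable from tied data without a dense excursion
   of the σ-family of solutions (crux `ImplosionDichotomy.DenseExcursion`, 12586, OPEN); that caveat on B (σ₀ fixed
   before the solution; compressive solutions may leave the dilute regime) is board-known and operator-ruled
   (audit D5/Q2), not a refutation.
4. CONSEQUENTLY the item's truth value is B's (A being believed) and its DIFFICULTY is "B from A": the recorded SIZE
   objection (collisional twin `CollisionalFluxLdDecay`, velocity tails under the TRUE law, virial EOS
   identification, exponential local-Gibbs LLN — none a hypothesis of the typed item) stands. This file adds three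
   CHECKED facts to that record: the tie is used (§2), the balance laws are used (§3), and the tail term is OUTSIDE
   the entropy method (§4: cubic exponential moments are infinite under every Maxwellian — OVY 1993 p. 525 bounded
   the velocities for exactly this reason; tree barrier `HighMomentumCutoff`, Nachtergaele–Yau Assumption II.1).
5. ON THE ARCHITECTURE RISK (item note rreview-0815T13-16: "block localisation pays O(N) entropy"). Paper
   bookkeeping redone this cycle: per kinetic window the entropy-inequality increment is
   `(h/β)·[H(f_t|ψ_t) + log E_{ψ_t} e^{βX̄}]` (`X̄` = window average of the `O(N)` current functional, `β ≤ κ/C`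
   fixed by A's amplitude clause), so a localisation error `E_N` inside `log E_ψ e^{βX̄}` accumulates to
   `(T/β)·E_N` over the `T/h` windows — NOT `(T/h)·E_N`: an `o(N)`-PER-WINDOW localisation suffices. With blocks of
   FIXED macroscopic side `R` (let `N → ∞` first, then `R → 0`, then `δ → 0`): freezing `λ` blockwise costs a
   Rényi divergence `O(N R² ‖∇λ‖²)` (Hölder `p = 2` halves the admissible amplitude), boundary crossings cost
   `O(N h v/R) → 0`, and using A blockwise needs (i) A in every frame `(a, u₀, θ)` — GIVEN by its quantifiers — and
   (ii) an LD-level FINITE SPEED OF INFLUENCE to factorise the joint exponential moment over the `R⁻³` blocks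
   (else Hölder over blocks multiplies the amplitude by `R⁻³`); then
   `limsup_N H_N(T)/N ≤ e^{T/β} T (δ R⁻³ + C R²)/β → 0`. So the architecture is CONSISTENT modulo LD locality —
   which is `InfluenceLocality` (13916) IN ITS LD FORM, flagged "possibly false" by its own planner (collision
   cascades), whose first-moment repair does NOT suffice for this Gronwall. That is the sharpest statement of the
   risk I can make; it is not a refutation.
6. ATTACKS RUN (all inert unless listed in §2–§4): junk audits of A and B (interval integral, lintegral
   measurability, probability clauses, small `N` absorbed by `C`, `T ≤ 0` vacuous on both sides, `σ₀` is the
   prover's choice, junk EOS, `Torus.gradient` junk needs a non-differentiable pressure field — false in the dilute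
   regime, `klDiv = ∞` excluded since `Φ_t` preserves Liouville and the reference density is positive on the
   domain, `Measure.map` of a non-measurable map excluded by `measurable_flow`); degenerate profiles (`a₀` or `θ₀`
   vanishing give `G_N = 0` but are excluded by `0 < a₀`, `0 < θ₀`); exhibitable Euler solutions (constants, shear);
   single-hypothesis deletions in B (§2, §3); antecedent-side mutations (every variant keeps A as antecedent, hence
   is decidable only modulo A); literature (`lit search` DEGRADED this session — searchd unavailable; the barrier
   file's page-level quotes of OVY 1993 §1 p. 525 and Nachtergaele–Yau 2003 §2.3 were used instead). -/
theorem why_it_resists : True := trivial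

/-- **Bookkeeping lemma for item 5 of `why_it_resists` (discrete window Gronwall).** If the relative entropy
obeys, window by window, `H(k+1) ≤ (1 + h/γ)·H(k) + (h/γ)·M` with `H(0) = 0` (entropy inequality at parameter
`γ/h` applied to the window increment `h·X̄`, `M` a bound for the PER-WINDOW log-moment `log E_ψ e^{γX̄}`), then
after `n` windows `H(n) ≤ (n h/γ)·M·(1 + h/γ)ⁿ ≤ (T/γ)·M·e^{T/γ}` (`T = n h`): the per-window moment bound enters
ONCE times `T/γ`, not `T/h` times — an `o(N)` localisation error PER WINDOW is enough. [folklore] -/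
theorem discreteWindowGronwall (H : ℕ → ℝ) {h γ M : ℝ} (hh : 0 ≤ h) (hγ : 0 < γ) (hM : 0 ≤ M)
    (h0 : H 0 = 0) (hstep : ∀ k, H (k + 1) ≤ (1 + h / γ) * H k + h / γ * M) (n : ℕ) :
    H n ≤ n * h / γ * M * (1 + h / γ) ^ n := by
  have hq : 1 ≤ 1 + h / γ := le_add_of_nonneg_right (div_nonneg hh hγ.le)
  induction n with
  | zero => simp [h0]
  | succ n ih =>
    have hpow : 1 ≤ (1 + h / γ) ^ (n + 1) := one_le_pow₀ hq
    have hhg : 0 ≤ h / γ := div_nonneg hh hγ.le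
    have h1 : (1 + h / γ) * H n ≤ (1 + h / γ) * (n * h / γ * M * (1 + h / γ) ^ n) :=
      mul_le_mul_of_nonneg_left ih (zero_le_one.trans hq)
    have h2 : h / γ * M ≤ h / γ * M * (1 + h / γ) ^ (n + 1) :=
      le_mul_of_one_le_right (mul_nonneg hhg hM) hpow
    calc H (n + 1) ≤ (1 + h / γ) * H n + h / γ * M := hstep n
      _ ≤ (1 + h / γ) * (n * h / γ * M * (1 + h / γ) ^ n) + h / γ * M * (1 + h / γ) ^ (n + 1) :=
          add_le_add h1 h2
      _ = ((n + 1 : ℕ) : ℝ) * h / γ * M * (1 + h / γ) ^ (n + 1) := by push_cast; ring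

/-- … and the geometric factor is at most `e^{T/γ}`, `T = n h`. [folklore] -/
theorem discreteWindowGronwall_exp (H : ℕ → ℝ) {h γ M : ℝ} (hh : 0 ≤ h) (hγ : 0 < γ) (hM : 0 ≤ M)
    (h0 : H 0 = 0) (hstep : ∀ k, H (k + 1) ≤ (1 + h / γ) * H k + h / γ * M) (n : ℕ) :
    H n ≤ n * h / γ * M * Real.exp (n * h / γ) := by
  refine (discreteWindowGronwall H hh hγ hM h0 hstep n).trans ?_
  have hhg : 0 ≤ h / γ := div_nonneg hh hγ.le
  have hpow : (1 + h / γ) ^ n ≤ Real.exp (n * h / γ) := by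
    calc (1 + h / γ) ^ n ≤ (Real.exp (h / γ)) ^ n := by
          gcongr
          linarith [Real.add_one_le_exp (h / γ)]
      _ = Real.exp (n * h / γ) := by rw [← Real.exp_nat_mul]; ring_nf
  exact mul_le_mul_of_nonneg_left hpow (by positivity)

/-! ## §6 Dead ends (one line each) -/

/-- DEAD ENDS.
* unconditional `¬crux`: needs `⊢ KineticFluxLdDecay` (open) — dead for every cycle until 10967 is proved.
* `¬B` via the junk EOS / a super-dense constant state: killed by the tie (tied mass is `1`) — recycled as §2.
* `¬B` via non-conservative smooth fields: killed by the balance laws (mass conservation, EOS-free, tree: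
  `DenseExcursionEverywhere.integral_density_eq`) — recycled as §3.
* `¬B` on steady shear flows: B physically true at Euler scaling (viscous heating `O(N^{2/3})` per unit time).
* negative lemma modulo `H := A`: `A → ¬crux ⟺ A → ¬B` — needs `¬B`; no.
* toy refutation of the NAIVE transfer `log∫e^X dν ≤ log∫e^X dμ + H(ν|μ)`: false (two-point space, `ν = Ber(0.9)`,
  `μ = Ber(1/2)`, `X = 𝟙`: `0.9 > 0.9^{0.9}·0.1^{0.1} ≈ 0.72`) but the plan uses the (correct) entropy inequality,
  not this; recorded here, not formalised.
* strengthening B's rate clause or klDiv normalisation: not natural for a glue item; skipped. -/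
theorem dead_ends : True := trivial

/-! ## §7 The antecedent speaks of ONE reduced density: the activity is a dummy -/

/-- A constant activity factors out of the local Gibbs profile. [folklore] -/
theorem localGibbsProfile_const_activity (a θ : ℝ) (u : V3) (y : T3 × V3) :
    localGibbsProfile (fun _ => a) (fun _ => u) (fun _ => θ) y =
      a * localGibbsProfile (fun _ => (1 : ℝ)) (fun _ => u) (fun _ => θ) y := by
  simp [localGibbsProfile]

/-- Tensor powers are multiplicative in a constant factor. [folklore] -/
theorem tensorPow_const_mul {n : ℕ} (a : ℝ) (f : T3 × V3 → ℝ) :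
    tensorPow n (fun y => a * f y) = fun z : Config n (Fin 3) T3 => a ^ n * tensorPow n f z := by
  funext z
  simp [tensorPow, Finset.prod_mul_distrib, Finset.prod_const]

/-- The canonical density does not see a non-zero constant factor in the one-particle profile (it cancels
against the partition function; if the partition function vanishes both sides are the junk `0`). [folklore] -/
theorem canonicalDensity_const_mul {n : ℕ} {a : ℝ} (ha : a ≠ 0) (ε : ℝ) (f : T3 × V3 → ℝ)
    (z : Config n (Fin 3) T3) :
    canonicalDensity (Torus.geometry (Fin 3)) ε n (fun y => a * f y) z =
      canonicalDensity (Torus.geometry (Fin 3)) ε n f z := by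
  set D := hardSphereDomain (Torus.geometry (Fin 3)) n ε with hD
  have hind : D.indicator (tensorPow n (fun y => a * f y)) =
      fun z => a ^ n * D.indicator (tensorPow n f) z := by
    funext w
    rw [tensorPow_const_mul]
    by_cases hw : w ∈ D <;> simp [hw]
  have hZ : canonicalPartition (Torus.geometry (Fin 3)) ε n (fun y => a * f y) =
      a ^ n * canonicalPartition (Torus.geometry (Fin 3)) ε n f := by
    simp only [canonicalPartition, ← hD, hind]
    exact integral_const_mul _ _
  have han : (a ^ n)⁻¹ * a ^ n = 1 := inv_mul_cancel₀ (pow_ne_zero n ha)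
  simp only [canonicalDensity, ← hD, hZ, hind]
  calc (a ^ n * canonicalPartition (Torus.geometry (Fin 3)) ε n f)⁻¹ * (a ^ n * D.indicator (tensorPow n f) z)
      = ((a ^ n)⁻¹ * a ^ n) * ((canonicalPartition (Torus.geometry (Fin 3)) ε n f)⁻¹ *
          D.indicator (tensorPow n f) z) := by rw [mul_inv]; ring
    _ = _ := by rw [han, one_mul]

/-- **The activity is decorative at fixed particle number**: for `a ≠ 0` the constant-profile local Gibbs law
(the global Gibbs law `G_N` of the antecedent) does not depend on `a`. (Same lemma as in the sibling disprover file
`Cruxes/BoltzmannGreenKubo/Disproof.lean` §1c, re-proved here to keep this file import-stable.) [folklore] -/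
theorem localGibbsLaw_const_activity {a : ℝ} (ha : a ≠ 0) (σ θ : ℝ) (u : V3) (N : ℕ)
    (Φ : HardSphereFlow (Torus.geometry (Fin 3)) (hsDiameter σ N) (N + 1)) :
    localGibbsLaw σ (fun _ => a) (fun _ => u) (fun _ => θ) N Φ =
      localGibbsLaw σ (fun _ => 1) (fun _ => u) (fun _ => θ) N Φ := by
  unfold localGibbsLaw
  have hprof : localGibbsProfile (fun _ => a) (fun _ => u) (fun _ => θ) =
      fun y => a * localGibbsProfile (fun _ => (1 : ℝ)) (fun _ => u) (fun _ => θ) y :=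
    funext (localGibbsProfile_const_activity a θ u)
  rw [hprof]
  congr 1
  funext z
  exact canonicalDensity_const_mul ha _ _ z

/-- `KineticFluxLdDecay` at the single activity `a = 1` (all else verbatim). -/
def KineticFluxLdDecayUnitActivity : Prop :=
  ∀ (θ : ℝ) (u₀ : V3), 0 < θ → ∃ σ₀ : ℝ, 0 < σ₀ ∧ ∀ σ : ℝ, 0 < σ → σ < σ₀ →
    (∀ (N : ℕ) (Φ : HardSphereFlow (Torus.geometry (Fin 3)) (hsDiameter σ N) (N + 1)),
      IsProbabilityMeasure (localGibbsLaw σ (fun _ => 1) (fun _ => u₀) (fun _ => θ) N Φ)) ∧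
    ∃ κ : ℝ, 0 < κ ∧ ∀ (φ : T3 → ℝ) (g : V3 → ℝ), Continuous φ → Continuous g → (∀ x, |φ x| ≤ 1) →
      (∀ v, |g v| ≤ κ) →
      (∀ (c₀ c₂ : ℝ) (b : V3), ∫ v, g v * (c₀ + inner ℝ b v + c₂ * ‖v‖ ^ 2) ∂(ProbabilityTheory.stdGaussian V3) = 0) →
      ∀ δ : ℝ, 0 < δ → ∃ τ : ℝ, 0 < τ ∧ ∃ N₀ : ℕ, ∀ N : ℕ, N₀ ≤ N →
        ∀ Φ : HardSphereFlow (Torus.geometry (Fin 3)) (hsDiameter σ N) (N + 1),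
          ∫⁻ z, ENNReal.ofReal (Real.exp ((τ * ((N + 1 : ℕ) : ℝ) ^ (-(1 / 3 : ℝ)))⁻¹ *
              ∫ s in (0 : ℝ)..(τ * ((N + 1 : ℕ) : ℝ) ^ (-(1 / 3 : ℝ))),
                ∑ i, φ (Φ.flow s z i).1 * g ((Real.sqrt θ)⁻¹ • ((Φ.flow s z i).2 - u₀))))
            ∂(localGibbsLaw σ (fun _ => 1) (fun _ => u₀) (fun _ => θ) N Φ) ≤
          ENNReal.ofReal (Real.exp (δ * (N + 1)))

/-- **The `∀ a` of the antecedent is vacuous repetition**: `KineticFluxLdDecay ↔ KineticFluxLdDecayUnitActivity`.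
Consequence (density-range bookkeeping, BN1 of the round-1 barrier notes): A is a statement about ONE state per `σ`
— `N + 1` spheres of diameter `σ(N+1)^{-1/3}` in the unit torus, uniform positions, Maxwellian velocities, i.e.
macroscopic density `1` — so every use of A at the local density `ρ(t,x)` of the Euler solution goes through
RE-EMBEDDING a block at reduced parameter `σ ρ^{1/3}` (`hsDiameter_reembed`), and the Gronwall along a solution with
`sup ρ = ρ_max` consumes A on the whole interval `σ' ∈ (0, σ ρ_max^{1/3}]`, available from A's `∀ σ' < σ₀` clause only
while `σ ρ_max^{1/3} < σ₀(A)`; B fixes its `σ₀` BEFORE the Euler solution is quantified, whose `ρ_max` is not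
bounded a priori (dense excursions: crux `ImplosionDichotomy.DenseExcursion`, stmt-12586, open). [folklore] -/
theorem kineticFluxLdDecay_iff_unitActivity : KineticFluxLdDecay ↔ KineticFluxLdDecayUnitActivity := by
  constructor
  · intro h θ u₀ hθ
    exact h 1 θ u₀ one_pos hθ
  · intro h a θ u₀ ha hθ
    obtain ⟨σ₀, hσ₀, H⟩ := h θ u₀ hθ
    refine ⟨σ₀, hσ₀, fun σ hσ hσ' => ?_⟩
    simp only [localGibbsLaw_const_activity ha.ne']
    exact H σ hσ hσ'

/-- **Re-embedding arithmetic** (block self-similarity at fixed reduced density): a block of side `R` of the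
`σ`-system at local macroscopic density `ρ` holds `N' + 1 = ρ R³ (N+1)` spheres of diameter `σ(N+1)^{-1/3}`; rescaled
to the unit torus their diameter is `σ(N+1)^{-1/3}/R = (σ ρ^{1/3}) (N'+1)^{-1/3}` — the `σ`-system at density `ρ` IS
the `σρ^{1/3}`-system at density `1`. [folklore] -/
theorem hsDiameter_reembed {σ ρ R : ℝ} (hρ : 0 < ρ) (hR : 0 < R) {N N' : ℕ}
    (h : ((N' + 1 : ℕ) : ℝ) = ρ * R ^ 3 * ((N + 1 : ℕ) : ℝ)) :
    hsDiameter σ N / R = hsDiameter (σ * ρ ^ (1 / 3 : ℝ)) N' := by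
  unfold hsDiameter
  have hM : (0 : ℝ) < ((N + 1 : ℕ) : ℝ) := by positivity
  rw [h, Real.mul_rpow (by positivity) hM.le, Real.mul_rpow hρ.le (by positivity)]
  have h1 : (R ^ 3 : ℝ) ^ (-(1 / 3 : ℝ)) = R⁻¹ := by
    rw [show (R ^ 3 : ℝ) = R ^ ((3 : ℕ) : ℝ) from (Real.rpow_natCast R 3).symm, ← Real.rpow_mul hR.le]
    norm_num
    exact Real.rpow_neg_one R
  have h2 : ρ ^ (1 / 3 : ℝ) * ρ ^ (-(1 / 3 : ℝ)) = 1 := by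
    rw [← Real.rpow_add hρ]; norm_num
  rw [h1]
  calc σ * ((N + 1 : ℕ) : ℝ) ^ (-(1 / 3 : ℝ)) / R
      = σ * (ρ ^ (1 / 3 : ℝ) * ρ ^ (-(1 / 3 : ℝ))) * R⁻¹ * ((N + 1 : ℕ) : ℝ) ^ (-(1 / 3 : ℝ)) := by
        rw [h2]; ring
    _ = σ * ρ ^ (1 / 3 : ℝ) * (ρ ^ (-(1 / 3 : ℝ)) * R⁻¹ * ((N + 1 : ℕ) : ℝ) ^ (-(1 / 3 : ℝ))) := by ring

/-! ## §8 The amplitude budget of the window Gronwall (BN1 / X2 of the round-1 panel), as limits -/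

/-- **Bounded class: no cut-off schedule closes.** With the antecedent's sup-norm class `|g| ≤ κ`, the truncated
energy-current symbol at level `A` has sup `≍ A³`, so the entropy-inequality parameter is `β ≤ κ/A³` and the Gronwall
exponent over a horizon `T` is `T A³/κ`, while a Gaussian velocity tail under the true law gains only `c A²`:
the net exponent `T A³/κ − c A²` tends to `+∞` — every schedule `A → ∞` loses, and a FIXED `A` leaves an extensive
tail error. (Real-variable content of the panel's finding; numbers in TRIAGE-r1-*.md.) [folklore] -/
theorem cubic_budget_diverges {κ T : ℝ} (hκ : 0 < κ) (hT : 0 < T) (c : ℝ) :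
    Tendsto (fun A : ℝ => T * A ^ 3 / κ - c * A ^ 2) atTop atTop := by
  have h1 : Tendsto (fun A : ℝ => A ^ 2) atTop atTop := tendsto_pow_atTop two_ne_zero
  have h2 : Tendsto (fun A : ℝ => T / κ * A - c) atTop atTop :=
    tendsto_atTop_add_const_right _ (-c) (tendsto_id.const_mul_atTop (by positivity))
  have h3 := h1.atTop_mul_atTop₀ h2
  refine h3.congr' (Eventually.of_forall fun A => ?_)
  simp only
  ring

/-- **Quadratic class: the budget closes.** With `|g(w)| ≤ κ(1 + ‖w‖²)` (the re-typing proposed by ideators 2 and 3: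
`KineticFluxLdDecayQuad` / `QuadraticClassLdDecay`) the truncated energy current divided by `A` is admissible with an
`A`-independent constant `C`, the Gronwall exponent is `C T A/κ` and the Gaussian tail `c A²` wins:
`C T A/κ − c A² → −∞` (Nachtergaele–Yau's `δ⁻¹M` versus `e^{-cM²}`). [folklore] -/
theorem quadratic_budget_closes {c : ℝ} (hc : 0 < c) (κ C T : ℝ) :
    Tendsto (fun A : ℝ => C * T * A / κ - c * A ^ 2) atTop atBot := by
  have h1 : Tendsto (fun A : ℝ => A) atTop atTop := tendsto_id
  have h2 : Tendsto (fun A : ℝ => C * T / κ - c * A) atTop atBot := by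
    have : Tendsto (fun A : ℝ => -c * A) atTop atBot :=
      tendsto_id.const_mul_atTop_of_neg (by linarith)
    simpa [sub_eq_add_neg, neg_mul] using tendsto_atBot_add_const_left _ (C * T / κ) this
  have h3 := h1.atTop_mul_atBot₀ h2
  refine h3.congr' (Eventually.of_forall fun A => ?_)
  simp only
  ring

/-! ## §9 The consequent's STATIC shadow: representability of the Euler density by a local Gibbs activity -/

/-- Clauses (i)–(ii) of the consequent's conclusion at the times `t ∈ [0,T)`: SOME activity profile `a` makes
`localGibbsLaw σ a (u t) (θ t)` a probability measure whose three empirical fields concentrate exponentially around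
`(ρ_t, ρ_t u_t, E_t)` — the entropy clause (iii) deleted. Purely STATIC in `(ρ_t, u_t, θ_t)`. -/
def RepresentableAt (σ T : ℝ) (ρ θ : ℝ → T3 → ℝ) (u : ℝ → T3 → V3) (Φ : Flows σ) : Prop :=
  ∀ t ∈ Set.Ico 0 T, ∃ a : T3 → ℝ,
    (∀ N, IsProbabilityMeasure (localGibbsLaw σ a (u t) (θ t) N (Φ N))) ∧
    (∀ χ : T3 → ℝ, Continuous χ → ∀ δ : ℝ, 0 < δ → ∃ C : ℝ, 0 < C ∧ ∀ N : ℕ,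
      localGibbsLaw σ a (u t) (θ t) N (Φ N)
          {z | δ < |empiricalDensityField z χ - ∫ x, χ x * ρ t x|} ≤
        ENNReal.ofReal (C * Real.exp (-(C⁻¹ * (N + 1)))) ∧
      localGibbsLaw σ a (u t) (θ t) N (Φ N)
          {z | δ < ‖empiricalMomentumField z χ - ∫ x, (χ x * ρ t x) • u t x‖} ≤
        ENNReal.ofReal (C * Real.exp (-(C⁻¹ * (N + 1)))) ∧
      localGibbsLaw σ a (u t) (θ t) N (Φ N)
          {z | δ < |empiricalEnergyField z χ -
            ∫ x, χ x * totalEnergyDensity (ρ t x) (u t x) (θ t x)|} ≤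
        ENNReal.ofReal (C * Real.exp (-(C⁻¹ * (N + 1)))))

/-- **Density representability** — `RelEntropyVanishing` with its entropy clause deleted: for all profiles,
`∃ σ₀ ∀ σ < σ₀`, for EVERY classical hard-sphere-Euler solution tied to the local Gibbs data at `t = 0` and every
`t < T`, the Euler fields `(ρ_t, u_t, θ_t)` are the exponential-LLN limits of some local Gibbs law at reduced density
`σ`. A statement of equilibrium statistical mechanics along the solution; no dynamics of spheres. -/
def DensityRepresentable : Prop :=
  ∀ (a₀ θ₀ : T3 → ℝ) (u₀ : T3 → V3), Continuous a₀ → Continuous θ₀ → Continuous u₀ → (∀ x, 0 < a₀ x) →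
    (∀ x, 0 < θ₀ x) → ∃ σ₀ : ℝ, 0 < σ₀ ∧ ∀ σ : ℝ, 0 < σ → σ < σ₀ →
    ∀ (T : ℝ) (ρ θ : ℝ → T3 → ℝ) (u : ℝ → T3 → V3), IsHardSphereEulerSolution σ T ρ u θ →
    ∀ Φ : Flows σ, TendstoHydroFieldsAt (fun N => localGibbsLaw σ a₀ u₀ θ₀ N (Φ N)) Φ ρ u θ 0 →
      RepresentableAt σ T ρ θ u Φ

/-- **B carries a static obligation that A does not mention**: `RelEntropyVanishing → DensityRepresentable`.
Contrapositive use (the only door to `¬B` this seat can see): a classical solution from tied DILUTE data whose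
density at some `t < T` is NOT representable at reduced density `σ` — e.g. a dense excursion `ρ_t σ³ ≳ η_freezing`
somewhere, where no fluid local Gibbs state reproduces a smooth profile — would refute B for that `σ`, and B fixes
`σ₀(a₀,θ₀,u₀)` BEFORE the solution (hence before its horizon `T` and its compression) is quantified. Whether such
solutions exist from smooth dilute tied data is exactly crux `ImplosionDichotomy.DenseExcursion` (stmt-12586; its
standing disprover records RESISTS, with the EOS-free compression budget `ρ_t ≤ max ρ₀ · e^{Kt}` under `div u ≥ −K`,
`Theorems/DenseExcursion/Negative/CompressionBudget.lean`): in the bounded-compression class the reduced density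
along the solution stays `≤ σ (max ρ₀)^{1/3} e^{Kt/3}` and the door is shut. A, by §7, speaks of density `1` only. [folklore] -/
theorem relEntropyVanishing_imp_representable : RelEntropyVanishing → DensityRepresentable := by
  intro h a₀ θ₀ u₀ ha hθ hu ha0 hθ0
  obtain ⟨σ₀, hσ₀, H⟩ := h a₀ θ₀ u₀ ha hθ hu ha0 hθ0
  refine ⟨σ₀, hσ₀, fun σ hσ hσ' T ρ θ u hE Φ htie t ht => ?_⟩
  obtain ⟨-, H2⟩ := H σ hσ hσ' T ρ θ u hE Φ
  obtain ⟨a, hPa, hconc, -⟩ := H2 htie t ht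
  exact ⟨a, hPa, hconc⟩

/-- Hence, given the antecedent, the crux implies the static representability statement: any refutation of
`DensityRepresentable` is a refutation of the crux modulo A (and of the target 0766 outright). [folklore] -/
theorem crux_imp_representable_of_antecedent (hA : KineticFluxLdDecay) (h : KineticWindowGronwall) :
    DensityRepresentable :=
  relEntropyVanishing_imp_representable (h hA)

/-- The crux may be proved with the antecedent taken at activity `1` only (§7). [folklore] -/
theorem crux_iff_unitActivity_imp :
    KineticWindowGronwall ↔ (KineticFluxLdDecayUnitActivity → RelEntropyVanishing) := by
  rw [show KineticWindowGronwall = (KineticFluxLdDecay → RelEntropyVanishing) from rfl,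
    kineticFluxLdDecay_iff_unitActivity]


/-! ## §10 Notes on the typed children proposed in round 1 (pre-emptive stub audit, cycle 2) -/

/-- **NOTES ON THE TYPED CHILDREN (round-1 cards and sketches; for the lead and the ideators).** None is killable
cheaply; quantitative NECESSARY conditions are recorded.

1. AMPLITUDE CLAUSES ARE NECESSARY — AND NOW QUANTIFIED (invariant-tilt floor). For an admissibility class `𝒞` of
   one-body observables, the Donsker–Varadhan bound with the flow-INVARIANT tilted homogeneous Gibbs law (temperature
   `λθ`; the 10967 disprover's `tilt_lower_bound`, series `Theorems/KineticFluxLdDecay/Negative/*`) gives for EVERY window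
   `τ`, every `N` and `φ ≡ 1`: `(N+1)⁻¹ log E_{G_N} exp(h⁻¹∫₀ʰ Σᵢ g) ≥ E_{N(0,λI₃)} g − (3/2)(λ − 1 − log λ)`. Hence a
   class-`𝒞` kinetic-window LD statement at amplitude `c` is FALSE as soon as `c > c_crit(𝒞) := inf_λ I(λ)/F_𝒞(λ)`,
   `F_𝒞(λ) := sup {E_λ g : g ∈ 𝒞 at amplitude 1, g ⊥ 1, v, |v|²}` (a linear programme; radial `g` and temperature tilts
   only — drift tilts and non-radial `g` can only LOWER `c_crit`). Numbers (this seat: LP dual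
   `F = min_{α,β} ∫ cap(s)|p_λ − (α + βs²)p₁| ds` on a grid, pure-python replica `tiltfloor_pure.py`; kit job j010257 =
   `tiltfloor.py`, finer grid, attached to the item as evidence when it runs):
   - BOUNDED class `|g| ≤ κ` (the typed 10967 clause): `κ_crit = 0.977` at `λ* = 0.50` — reproduces the recorded floor
     "`κ < 0.977` (two-level radial g)" exactly, which validates the machinery;
   - QUADRATIC class `|g(w)| ≤ c(1 + ‖w‖²)` (`IdeatorThree.KineticFluxLdDecayQuad`,
     `RareBandResidenceLadder.QuadraticClassLdDecay`): `c_crit = 0.177` at `λ* = 1.28`;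
   - RARE BAND `|g(w)| ≤ c‖w‖²`, `g = 0` on `‖w‖ ≤ V₁` (`RareBandResidenceLadder.RareBandLdDecay`):
     `c_crit(V₁) = 0.214 (V₁ = 0), 0.215 (0.5), 0.223 (1), 0.248 (1.5), 0.285 (2), 0.325 (2.5), 0.360 (3)`, increasing to the
     static ceiling `1/2` as `V₁ → ∞` (`λ* = 1.6 … 6`).
   So "finite statically for `c⋆ < 1/2`" (card rare-band-residence-ladder) is NOT the operative constraint: the `∃ c⋆` of
   these re-typings must deliver `c⋆ < 0.18 – 0.21`; consistent (the clause is existential) and compatible with the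
   AmplitudeLadder constant `min(c⋆, κ/(2(1+V₁²)))`, but every numerical test of the line should be run below these values.
2. `AmplitudeLadder` (`KineticFluxLdDecay → RareBandLdDecay → QuadraticClassLdDecay`): the sketch "split
   `g = gχ + g(1−χ)`, re-orthogonalise each piece; the corrections are collision-invariant polynomials whose window
   functionals are conserved-field functionals bounded statically" has a GAP AS WORDED: a conserved-field functional
   `Σᵢ φ(xᵢ) p(wᵢ)`, `p ∈ span(1, w, |w|²)`, `φ` non-constant, is frozen over a kinetic window (`h → 0`), so it carries FULL
   Drude weight and its pressure is the static `≈ (N+1)·½(∫φ²)Var_γ(p)`, extensive — small only through the coefficients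
   of `p`, which are fixed by `g` and `χ` (`≲ c⋆V₁⁴e^{−V₁²/2}`: small, but not `→ 0` with `δ`). REPAIR: the two polynomial
   corrections are opposite (`p₁ + p₂ = 0` since `g, g₁, g₂ ⊥`), so choose the cut-off `χ = χ_g` depending on `g` with
   `gχ_g` EXACTLY orthogonal (five linear conditions on `χ` beyond `V₁`); then `g(1 − χ_g)` is orthogonal too and no
   remainder exists — solvable whenever `g·(1, wₖ, |w|²)` are linearly independent on the transition band, with the
   uniform bounds `sup|χ_g| ≤ 2`, `|gχ_g| ≤ κ` to be checked. Not a kill; a note for ideator 2 / the lead.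
3. `IdeatorThree.LocalKineticFluxLd`: non-invariant local Gibbs reference over ONE kinetic window — the Chapman–Enskog
   correction of the one-body law is `O(Kn) = O(N^{-1/3})` per particle, `o(N)` in the exponent: consistent.
   `LocalisationLemma`, `RareBandSlaving`, `quad_implies_uniform`: implications between open statements (the last one
   is one line), decidable only through their antecedents.
4. `IdeatorThree.GaussianShellMoment`: PROVED below (§10b, `gaussianShellMoment_holds`, same term restated: on the shell
   `e^{−κ‖p‖²} ≤ e^{−κA²/2}e^{−κ‖p‖²/2}`, `K = (2π/κ)^{3/2}`) — a brick, not a stub. `GaussianTailsAlongEvolution := ∃σ₀ ∀σ<σ₀, HighMomentumCutoff σ`: honest and open — junk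
   audit of `HighMomentumCutoff`: `c` is chosen after the profiles and `Φ` but BEFORE `N`; energy conservation alone
   bounds the moment only by `E_{G}e^{cΣ|vⱼ|²} = e^{O(cN)}`, not `O(1)`; no junk-false path (`G_N ≪ Liouville`, good set
   conull; `N = 0` is one free particle, fine).
5. `InfluenceLocality` (13916, LD form, AntiMazur's own crux, not this item): the cheapest EXTENSIVE corruption
   mechanism found is a gas of Newton's-cradle chains (`2R/σ` near-contacts in a row; the far half of each chain is
   influenced from beyond `R` within `T`); cost per bad particle `≍ c·log(R/(σT))` (gap `≲ σT/R` per link, alignment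
   `O(log R)`), so the LD rate DOES tend to `∞` with `R`, but only logarithmically: the statement is consistent with
   `R(lam) ≳ σT·e^{lam/c}` (exponentially large range in the tilt parameter). Recorded for that crux's seats. -/
theorem notes_on_typed_children : True := trivial

/-! ## §10b A brick settled: `GaussianShellMoment` holds -/

/-- Ideator 3's brick `IdeatorThree.GaussianShellMoment` (same term, restated so that this file does not import a
crux work file): for `0 < c < 1/(2θ)` the quadratic exponential moment of the Maxwellian weight restricted to the shell
`{‖p‖ > A}` decays like `exp(−(1/(2θ) − c) A²/2)`. -/
def GaussianShellMoment : Prop :=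
  ∀ θ c : ℝ, 0 < θ → 0 < c → c < 1 / (2 * θ) → ∃ K : ℝ, 0 < K ∧ ∀ A : ℝ, 0 ≤ A →
    ∫⁻ p in {p : V3 | A < ‖p‖}, ENNReal.ofReal (Real.exp (c * ‖p‖ ^ 2 - ‖p‖ ^ 2 / (2 * θ))) ≤
      ENNReal.ofReal (K * Real.exp (-((1 / (2 * θ) - c) / 2) * A ^ 2))

/-- **`GaussianShellMoment` is TRUE** (so it is a brick, not a stub): with `κ = 1/(2θ) − c > 0`, on the shell
`e^{−κ‖p‖²} ≤ e^{−κA²/2} e^{−κ‖p‖²/2}`, and `K = ∫ e^{−κ‖p‖²/2} dp = (2π/κ)^{3/2}`. [folklore] -/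
theorem gaussianShellMoment_holds : GaussianShellMoment := by
  intro θ c hθ hc hcθ
  set κ : ℝ := 1 / (2 * θ) - c with hκ
  have hκpos : 0 < κ := by rw [hκ]; linarith
  have hb : 0 < κ / 2 := by positivity
  have hint : Integrable (fun v : V3 => Real.exp (-(κ / 2) * ‖v‖ ^ 2)) :=
    Literature.Analysis.FunctionSpaces.integrable_rexp_neg_mul_sq_norm hb
  set K : ℝ := ∫ v : V3, Real.exp (-(κ / 2) * ‖v‖ ^ 2) with hK
  have hKpos : 0 < K := by
    rw [hK, GaussianFourier.integral_rexp_neg_mul_sq_norm hb]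
    positivity
  refine ⟨K, hKpos, fun A hA => ?_⟩
  have hpt : ∀ p ∈ {p : V3 | A < ‖p‖}, ENNReal.ofReal (Real.exp (c * ‖p‖ ^ 2 - ‖p‖ ^ 2 / (2 * θ))) ≤
      ENNReal.ofReal (Real.exp (-(κ / 2) * A ^ 2) * Real.exp (-(κ / 2) * ‖p‖ ^ 2)) := by
    intro p hp
    refine ENNReal.ofReal_le_ofReal ?_
    rw [← Real.exp_add]
    refine Real.exp_le_exp.2 ?_
    have hp' : A < ‖p‖ := hp
    have hA2 : A ^ 2 ≤ ‖p‖ ^ 2 := by nlinarith [norm_nonneg p]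
    have h1 : c * ‖p‖ ^ 2 - ‖p‖ ^ 2 / (2 * θ) = -κ * ‖p‖ ^ 2 := by rw [hκ]; ring
    rw [h1]
    nlinarith [hκpos]
  calc ∫⁻ p in {p : V3 | A < ‖p‖}, ENNReal.ofReal (Real.exp (c * ‖p‖ ^ 2 - ‖p‖ ^ 2 / (2 * θ)))
      ≤ ∫⁻ p in {p : V3 | A < ‖p‖},
          ENNReal.ofReal (Real.exp (-(κ / 2) * A ^ 2) * Real.exp (-(κ / 2) * ‖p‖ ^ 2)) :=
        setLIntegral_mono' (measurableSet_lt measurable_const measurable_norm) hpt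
    _ ≤ ∫⁻ p, ENNReal.ofReal (Real.exp (-(κ / 2) * A ^ 2) * Real.exp (-(κ / 2) * ‖p‖ ^ 2)) :=
        setLIntegral_le_lintegral _ _
    _ = ENNReal.ofReal (Real.exp (-(κ / 2) * A ^ 2)) *
          ∫⁻ p, ENNReal.ofReal (Real.exp (-(κ / 2) * ‖(p : V3)‖ ^ 2)) := by
        rw [← lintegral_const_mul' _ _ ENNReal.ofReal_ne_top]
        refine lintegral_congr fun p => ?_
        rw [ENNReal.ofReal_mul (Real.exp_pos _).le]
    _ = ENNReal.ofReal (Real.exp (-(κ / 2) * A ^ 2)) * ENNReal.ofReal K := by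
        rw [hK, ofReal_integral_eq_lintegral_ofReal hint (ae_of_all _ fun v => (Real.exp_pos _).le)]
    _ = ENNReal.ofReal (K * Real.exp (-(κ / 2) * A ^ 2)) := by
        rw [← ENNReal.ofReal_mul (Real.exp_pos _).le, mul_comm]

/-! ## §11 Why it resists — cycle 2 addendum, and dead ends -/

/-- **WHY IT RESISTS (cycle 2 addendum, 2026-08-16; refuter-cdisprove-stmt-AtomisticToContinuum-9282-g2-0).**
1. The normal form stands: a kill is `⊢ A ∧ ¬B`. A re-audited: the activity is a dummy (§7: ONE state per `σ`); thermal
   scaling is exact and the Galilean boost exact up to the `o(N)` shift `φ(x + ws) − φ(x)` over `h → 0`; `HardSphereFlow`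
   has no junk inhabitant on a `G_N`-positive set (`isTrajectory` on a conull good set + forward uniqueness). B re-audited:
   the `∃ a` freedom only helps the prover; `klDiv` has no junk-zero path; `T ≤ 0` is vacuous on both sides; the ONLY
   certifiable classical solutions — the EOS VALUES are unknown on the dilute range, so no candidate with `∇ρ ≠ 0` or
   `∇θ ≠ 0` can even be verified — are the EOS-free ones: constants, steady parallel shear `u = (f(x₂,x₃),0,0)`, and the
   unsteady sheared shear `u = (a(x₃), b₀(x₁ − a(x₃)t, x₃), 0)` (`ρ, θ` constant; classical for all `T`): on all of them
   B is statics (§4b) plus `O(N^{2/3})`-per-unit-time viscous entropy production, `o(N)` — physically true, not refutable;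
   Kelvin–Helmholtz growth `e^{λt}N^{-1/2}` is invisible at fixed `t` as `N → ∞`; time reversal and the athermal scaling
   `(ρ,u,θ)(t) ↦ (ρ, μu, μ²θ)(μt)` (12586 seat, `Theorems/DenseExcursion/Negative/AthermalScaling.lean`) map the class to itself.
2. The one door to `¬B` is static (§9): a non-representable dense excursion — shut in the bounded-compression class by the
   EOS-free maximum principle `ρ_t ≤ max ρ₀ e^{Kt}` (12586 seat), open only together with 12586 itself.
3. The round-1 panel's proof-architecture objections are now Lean-indexed in this file: amplitude budget (§8), density
   range (§7, `hsDiameter_reembed`), tail outside the entropy method (§4), tie / balance laws load-bearing (§2–§3),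
   per-window `o(N)` localisation suffices (§5), amplitude floors of the proposed re-typings (§10).
4. Literature (cycle 2): `lit search` rc 75 (searchd unavailable) ×2; galaxy bm25 over web PDFs ×2 ("relative entropy
   method … deterministic hard spheres … velocity cutoff"; "large deviations of time-averaged currents, hard sphere gas,
   slow modes / hidden conserved quantities") — no negative result in print surfaced; nearest context unchanged
   (OVY 1993 §1 p. 525, Nachtergaele–Yau 2003 Assumption II.1, the BGSS ICM survey). -/
theorem why_it_resists_c2 : True := trivial

/-- DEAD ENDS (cycle 2, one line each).
* tilt floors against the `∃`-amplitude re-typings (Quad / RareBand / Uniform): the amplitude is existential — floors give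
  necessary constants (§10), never a kill.
* `¬B` on unsteady sheared-shear solutions: `o(N)` entropy production at Euler scaling; no.
* `¬B` via the `Torus.gradient` junk at the freezing kink of `Z`: needs a certified solution crossing `ρσ³ = η_f` with
  `∇ρ ≠ 0` — generically impossible for smooth fields (`∇p` jumps) and the `Z`-values are unknown; no.
* `¬HighMomentumCutoff` via energy concentration on one sphere: LD-costly and the bound is in expectation with `c`
  chosen after `Φ`; no.
* an LD-kill of `InfluenceLocality` via cradle chains: cost per bad particle `∝ log R → ∞`; no (note passed on, §10.5).
* importing the sibling work file `Cruxes/BoltzmannGreenKubo/Disproof.lean` for `localGibbsLaw_const_activity`: mutable —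
  re-proved locally instead (§7). -/
theorem dead_ends_c2 : True := trivial


/-! ## §12 Targets (cycle 3): the picked line `explosion-limited-jamming` — persistent contact laminates

The lead picked `Lines/explosion-limited-jamming.lean` (PICKED.md; six stubs). The parallel drefute seat has filed
`NegativeNotes-drefute-{MesoJammedSetLd, StaticClampedCollisionalLd, StaticClampDock, Survivors}.md` (2026-08-16T03:2x): STUB 2
stub-false by a torus-wrapping tight NECKLACE (precision-shadowed 1-D sub-gas, along a number-theoretic subsequence of `N`; repair
proposed there: a liftability guard), STUB 3 stub-misstated (clamp-marking noise floor; repair: `∀ ε` before `∃ L₀ g₁`), STUBS 1/4/5/6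
survive (1 TRUE). This section adds an INDEPENDENT, thermodynamic kill of STUB 2 that (a) works along ALL large `N`, (b) needs no
dynamical precision, (c) SURVIVES the liftability repair, and (d) dictates two further clauses of the repair; plus a necessary amplitude
bound for STUB 3 and a bookkeeping remark for STUB 6. Physics input is flagged explicitly (P below); nothing here is Lean-landable
against the stub (the Lines module has no `.olean`; the kill needs the true flow of a non-invariant law), so the Lean content of this
section is the quantifier skeleton (`forall_amp_horizon_false_of_linear_floor`, `exists_sigma0_cap`). -/

/-- **TARGET — STUB 2 `stub_mesoJammedSetLd : ClusterVirialBudget → MesoJammedSetLd` is PHYSICALLY FALSE AS TYPED (second,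
independent witness: PERSISTENT CONTACT LAMINATES; stub-misstated, repair below).** `ClusterVirialBudget` is true (drefute Survivors
note; re-derived §12 audit), so STUB 2 ⇔ `MesoJammedSetLd`:
`∀ a θ u₀ ∃ σ₀ ∀ σ<σ₀ ∀ Λ₁ Λ₂ (1<Λ₁≤Λ₂) ∀ T>0 ∀ β>0 ∀ ε>0 ∃ ρ₀ L g₀ τ₀ ∀ τ≥τ₀ ∃ N₀ ∀ Λ∈[Λ₁,Λ₂] ∀ N≥N₀ ∀ Φ:`
`E_{G_N} exp(β·mesoBadActivity) ≤ e^{ε(N+1)}`, `mesoBadActivity = ∫₀ᵀ Σᵢ 1{IsBad ∧ ¬IsMacro}(Φ_s z, i)·jact_i(s) ds ≥ 0`,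
`∫₀ᵀ jact_i ds = ε_N Σ_{collisions of i} ‖Δv_i‖` (all collisions of `i` while flagged; `ε_N = σℓ`, `ℓ = (N+1)^{-1/3}`).

WITNESS (units of the line: torus side 1, reference `G_N` homogeneous at temperature `θ`, density 1 — the activity is a dummy, §7).
Fix the statement's `σ`, a level `Λ := Λ₁`, and `T, β`. The LAMINATE `ψ_N`: the local Gibbs law with `u ≡ 0` and 1-D periodic profiles
normal to `e₁` of period `D = D_N` — "sheets" of density `ρ_s > Λ` (volume fraction `f`) alternating with "gas" of density `ρ_g < 1`,
`fρ_s + (1−f)ρ_g = 1`, temperatures in PRESSURE BALANCE `ρ_sθ_s Z_s = ρ_gθ_g Z_g` — with `ℓ ≪ fD`, `D ≪ ρ₀`, and `D² ≫ κT`,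
`κ ≈ 0.26 ℓ√θ/σ²` the heat diffusivity (all three hold for `D_N = K_N (TN^{-1/3})^{1/2}`, `K_N → ∞` slowly, `N` large — AFTER the
prover's `ρ₀, L, g₀, τ, N₀`; only the product `βT` enters the gain, so small `T` with large `β` realises the witness already at moderate `N`:
`σ = 0.2, T = 10⁻³, N = 10⁶` give `5√(κT) ≈ 0.04`). Four facts:
(L1) COST (statics, rigorous in principle — for velocity-only laminates even with equal partition functions, cf. the 10967 series
`Theorems/KineticFluxLdDecay/Negative/TiltBasics`): `H(ψ_N|G_N)/(N+1) → a := fρ_s[log ρ_s + v(θ_s/θ)] + (1−f)ρ_g[log ρ_g + v(θ_g/θ)] + O(σ³)`,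
`v(λ) = (3/2)(λ − 1 − log λ)`; INDEPENDENT of `D, L, g₀, ρ₀, τ`.
(L2) FLAGGED: a sheet-interior particle is `IsBad` through the OVERDENSITY clause at every radius `r ∈ [Lℓ, (fD)/2 − dist]`
(count `≈ ρ_s·(N+1)(4π/3)r³ ≥ Λ·(N+1)(4π/3)r³`; fluctuation margin `(ρ_s/Λ − 1)(4π/3)(r/ℓ)³ ≫ ((4π/3)(r/ℓ)³)^{1/2}` for `r ≫ ℓ(ρ_s/Λ−1)^{-2/3}`,
available since `fD/ℓ → ∞`), and `¬IsMacro` (the `ρ₀`-ball averages `≫ 1` periods: count `= (N+1)(4π/3)ρ₀³(1 + O(D/ρ₀)) < Λ·(…)`;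
for `ρ₀ ≥ (3/(4πΛ))^{1/3}` wrapped balls only lower the count). No near contact, no chain, every contact cluster is a dilute-gas pair:
the liftability guard of the drefute repair does NOT remove these particles.
(L3) PERSISTENT: `(ρ, u ≡ 0, θ)` with `∇p = 0` is an EXACT steady classical Euler solution for EVERY equation of state (contact
discontinuities at rest; mass, momentum `∇p = 0`, energy trivially); its first-order (Navier–Stokes–Fourier) evolution is heat diffusion
across the layers, time scale `D²/κ ∝ D²σ²N^{1/3}/√θ → ∞`: over `[0, T]` the laminate is frozen for large `N` (Knudsen number
`λ_mfp/D = ℓ/(√2πσ²D) → 0`).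
(L4) GAIN: along the true flow from `ψ_N`, sheet particles collide at the local-equilibrium rate; by the virial/Enskog identity
`Σ_{i} ε_N Σ_c ‖Δv_i‖ /time = 2·3·p_coll·Vol` (each collision serves both partners; `p_coll = (2π/3)σ³ρ²θ` per unit volume, dilute),
the activity of a dilute-sheet particle is `4πρ_sσ³θ_s = 4πσ³p_s` per unit time, so `E_{ψ_N}[mesoBadActivity] ≥ (1−o(1))·T·(N+1)·fρ_s·4πσ³p_s`.
By Donsker–Varadhan (`ofReal_exp_le_lintegral_withDensity`, tree):
  `(N+1)⁻¹ log E_{G_N} e^{β·mesoBadActivity} ≥ 4πσ³ (fρ_s) p_s · βT − a − o(1)`   along ALL large `N`.        (★)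
NUMBERS (this seat, script + table published as `Cruxes/KineticWindowGronwall/LaminateNumbers-c3.md`; `θ`-units, `p_s` matched to the
outside pressure):
* `Λ = 2`: `ρ_s = 4, f = 1/8` (sheet mass ½), `ρ_g = 4/7`, optimal `θ_g = 1.75θ, θ_s = 0.25θ`: `a = 1.03`, gain coefficient `2π`:
  (★) `≥ 2πσ³θ·βT − 1.03`, violated (`> ε`) once `βT > 0.165/(σ³θ)` (`σ = 0.2, θ = 1`: `βT > 21`).
* `Λ = 1 + η` (slight laminate, `ρ_s = 1+2η, ρ_g = 1−2η, θ_s = (1−2η)θ, θ_g = (1+2η)θ`, exact balance): `a = 5η² + O(η³)`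
  (`η = 0.1: a = 0.0516`), gain coefficient `2π(1+2η)(1−4η²)`: violated once `βT > 0.8η²/(σ³θ)` (`σ = 0.2, η = 0.1`: `βT > 1.0`).
* dock level `Λ ≍ c_p/σ³` (near-packed sheets, `Z_s ≈ 10`): `a ≈ (15/4)log(1/σ) + O(1)`, gain `≈ 6 p f βT`: `σ = 0.2`: violated once `βT ≳ 9·10²/θ`.
CONSEQUENCE. Because `∀ Λ₁>1 ∀ T ∀ β` stand AFTER `∃ σ₀` and BEFORE the refinement `∃ ρ₀ L g₀`, and `a(Λ₁) → 0` as `Λ₁ → 1⁺` while the gain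
does not: for EVERY `σ ∈ (0, σ₀)` and EVERY `(T, β)` the instance `Λ₁ = Λ₂ = 1 + η`, `5.2η² < πσ³θβT`, `ε = πσ³θβT` is violated, for every
choice of `ρ₀, L, g₀, τ₀, N₀` — none of which enters (★). The refinement suppresses SPONTANEOUS badness (`e^{−c(Λ)L³}`, `4πg₀σ³`) but not
ORGANISED slight overdensity, whose price is set by `Λ − 1`, not by `L`.
PHYSICS INPUT (P), stated once: (L3)–(L4) = local equilibrium with Navier–Stokes–Fourier relaxation for pressure-balanced entropy layers at
scales `≫ λ_mfp` under the TRUE hard-sphere flow — the kinetic-theory content of the hydrodynamic limit itself, unprovable today at fixed `σ`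
(hence no Lean kill and no `_false_of_` lemma worth landing: H would be a true-law statement). But a PROOF of STUB 2 as typed would REFUTE (P):
the line would be sawing the branch the summit sits on. (L1)–(L2) are statics/combinatorics and rigorous in principle.
MINIMAL REPAIR (cumulative with the drefute liftability guard, which handles the necklace but not this):
(R-a) quantify a LEVEL FLOOR and an AMPLITUDE–HORIZON CAP before `σ₀`:
  `∀ a θ u₀, ∀ Λ₁ > 1, ∀ K > 0, ∃ σ₀ > 0, ∀ σ ∈ (0,σ₀), ∀ Λ₂ ≥ Λ₁, ∀ T β, 0 < T → 0 < β → β * T ≤ K → ∀ ε > 0, ∃ ρ₀ L g₀ τ₀, … (verbatim)`;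
  the whole laminate family then misses the statement as soon as `2πσ₀³θK < a(Λ₁)` (`exists_sigma0_cap`), and what is left is again the
  open anti-focusing content K2 (plus the necklace remainder of the drefute note). DOCK-COMPATIBLE: the dock applies STUB 2 per macroscopic
  stretch `Δ ≤ 1` at ONE amplitude `β₁`, so `K := β₁·1`; a Gronwall RATE `c_λ/(β₁Δ)` need not vanish (only SOURCES must, `H(0) = 0` by the
  tie), so `β₁` can and MUST be chosen independently of the accuracy `ε` (the dock's printed order "accuracy ε → (A, C, β₁)" would make
  `σ₀ = σ₀(ε)` and degrade the conclusion to `limsup_N H/N ≤ ε` per `σ₀(ε)`, which is not `RelEntropyVanishing`); thermal/density rescaling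
  of the blockwise use (`σ_loc = σρ̂^{1/3}`, `θ_loc`) is absorbed by taking `β₁ ∝ 1/sup(ρ̂ θ_loc)` (solution-dependent, allowed inside the
  proof of B) at the price of a solution-dependent rate.
(R-b) OR count only EXCESS activity (above a local-equilibrium activity level `V`, the 13733/13734 clamp on top of the static one):
  laminate particles have normal activity and drop out — but then the excess-in-mean input under the TRUE law (13734-type) returns,
  which this line was designed to remove.
GENERAL LESSON for every Yau-family dock with a COLLISIONAL exponential-currency input selected by local-density clamps: persistent
Euler-steady microstructure (contact laminates) costs `O(a(Λ)·N)` once and pays activity `∝ σ³θ·N` per unit time forever; any such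
input must cap amplitude × horizon (or bound the level away from the mean density) BEFORE `σ₀`. [folklore] -/
theorem target_stub2_laminate : True := trivial

/-- **(L3), first half, as a theorem: contact laminates at rest are exact classical hs-Euler solutions for EVERY
equation of state.** Any smooth, positive, time-independent pair `(ρ₀, θ₀)` on `𝕋³` with spatially constant
hard-sphere pressure `ρ₀θ₀Z(ρ₀σ³) ≡ p₀` and `u ≡ 0` solves the system on every `[0, T)`: time derivatives vanish,
every flux is a multiple of `u ≡ 0`, and `∇p = ∇(const) = 0` — no property of `hsCompressibility` is used.
(Proposed copy: `Theorems/KineticWindowGronwall/Negative/StaticLaminates.lean`, p81001.) [folklore] -/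
theorem isHardSphereEulerSolution_static_isobaric (σ T p₀ : ℝ) {ρ₀ θ₀ : T3 → ℝ}
    (hρ : Torus.IsSmooth ρ₀) (hθ : Torus.IsSmooth θ₀) (hρ0 : ∀ x, 0 < ρ₀ x) (hθ0 : ∀ x, 0 < θ₀ x)
    (hp : ∀ x, hsPressure σ (ρ₀ x) (θ₀ x) = p₀) :
    IsHardSphereEulerSolution σ T (fun _ => ρ₀) (fun _ _ => 0) (fun _ => θ₀) where
  smooth_density := Torus.isSmoothSpaceTimeOn_const hρ _
  smooth_velocity := Torus.isSmoothSpaceTimeOn_const (Torus.isSmooth_const _) _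
  smooth_temperature := Torus.isSmoothSpaceTimeOn_const hθ _
  density_pos _ _ x := hρ0 x
  temperature_pos _ _ x := hθ0 x
  mass t _ x := by
    simp [Torus.timeDerivWithin, Torus.divergence, Torus.partialDeriv, Torus.lineDeriv]
  momentum t _ x := by
    have hfun : (fun y => hsPressure σ (ρ₀ y) (θ₀ y)) = fun _ => p₀ := funext hp
    rw [hfun]
    unfold Torus.gradient Torus.liftAt
    simp [Torus.timeDerivWithin, Torus.partialDeriv, Torus.lineDeriv, _root_.gradient]
  energy t _ x := by
    simp [Torus.timeDerivWithin, Torus.divergence, Torus.partialDeriv, Torus.lineDeriv]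

/-- **… and the solution class of B (and of 3091, 9235, 9518, 9519, `HighMomentumCutoff`) is non-trivially
inhabited at the degenerate parameter `σ = 0`** (`Z(ρ·0) = Z(0) = 1 + 0·deriv _ 0 = 1`): for every smooth positive
`ρ₀` and `p₀ > 0`, `(ρ₀, 0, p₀/ρ₀)` is a classical solution on every `[0,T)` — a certified NON-CONSTANT-density member.
At `σ > 0` the same profiles need `Z ∈ C^∞` on the range of `ρ₀σ³` (item 0768) or the junk branch `ρ₀σ³ > 512`; every
member certified so far at `σ > 0` has constant density (§13.1) — the precise shape of the EOS wall in front of `¬B`. [folklore] -/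
theorem isHardSphereEulerSolution_static_sigma_zero (T : ℝ) {p₀ : ℝ} (hp₀ : 0 < p₀) {ρ₀ : T3 → ℝ}
    (hρ : Torus.IsSmooth ρ₀) (hρ0 : ∀ x, 0 < ρ₀ x) :
    IsHardSphereEulerSolution 0 T (fun _ => ρ₀) (fun _ _ => 0) (fun _ x => p₀ / ρ₀ x) := by
  have hθ : Torus.IsSmooth (fun x => p₀ / ρ₀ x) := by
    unfold Torus.IsSmooth at hρ ⊢
    exact contDiff_const.div hρ fun y => (hρ0 _).ne'
  refine isHardSphereEulerSolution_static_isobaric 0 T p₀ hρ hθ hρ0 (fun x => div_pos hp₀ (hρ0 x)) fun x => ?_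
  simp only [hsPressure, hsCompressibility]
  have hx : (ρ₀ x) ≠ 0 := (hρ0 x).ne'
  field_simp
  ring

/-- **Quantifier skeleton of the kill.** If an LD rate `R β T p` has, for every refinement `p`, a floor LINEAR in `β·T`
(`c·βT − a ≤ R`, `c > 0` — the laminate: `c = 2πσ³θ`, `a = a(Λ₁)`), then the typed order `∀ T ∀ β ∀ ε ∃ p, R ≤ ε` is false. [folklore] -/
theorem forall_amp_horizon_false_of_linear_floor {P : Type*} (R : ℝ → ℝ → P → ℝ) {c a : ℝ} (hc : 0 < c)
    (h : ∀ β T : ℝ, ∀ p : P, 0 < β → 0 < T → c * (β * T) - a ≤ R β T p) :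
    ¬ ∀ T : ℝ, 0 < T → ∀ β : ℝ, 0 < β → ∀ ε : ℝ, 0 < ε → ∃ p : P, R β T p ≤ ε := by
  intro H
  set β : ℝ := (|a| + 1) / c with hβ
  have hβpos : 0 < β := by positivity
  obtain ⟨p, hp⟩ := H 1 one_pos β hβpos (1 / 2) (by norm_num)
  have hfloor := h β 1 p hβpos one_pos
  have hcβ : c * (β * 1) = |a| + 1 := by rw [mul_one, hβ]; field_simp
  have habs : a ≤ |a| := le_abs_self a
  linarith

/-- **… and the repair (R-a) defeats the laminate family**: with the cap `βT ≤ K` and the level floor `Λ₁` fixed BEFORE `σ₀`, the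
prover can choose `σ₀` with `c₀ σ₀³ θ K < a(Λ₁)` (`c₀ = 2π` dilute, `a(Λ₁) > 0` for `Λ₁ > 1`), so the floor (★) is negative on
`σ < σ₀`. [folklore] -/
theorem exists_sigma0_cap {a c₀ θ K : ℝ} (ha : 0 < a) (hc : 0 < c₀) (hθ : 0 < θ) (hK : 0 < K) :
    ∃ σ₀ : ℝ, 0 < σ₀ ∧ σ₀ ≤ 1 ∧ ∀ σ : ℝ, 0 < σ → σ < σ₀ → c₀ * σ ^ 3 * θ * K < a := by
  refine ⟨min 1 (a / (2 * (c₀ * θ * K))), by positivity, min_le_left _ _, fun σ hσ hσlt => ?_⟩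
  have hσ1 : σ < 1 := hσlt.trans_le (min_le_left _ _)
  have hσa : σ < a / (2 * (c₀ * θ * K)) := hσlt.trans_le (min_le_right _ _)
  have hσ3 : σ ^ 3 ≤ σ := by
    have h1 : σ ^ 3 ≤ σ ^ 1 := pow_le_pow_of_le_one hσ.le hσ1.le (by norm_num)
    simpa using h1
  have hpos : 0 < c₀ * θ * K := by positivity
  calc c₀ * σ ^ 3 * θ * K = (c₀ * θ * K) * σ ^ 3 := by ring
    _ ≤ (c₀ * θ * K) * σ := mul_le_mul_of_nonneg_left hσ3 hpos.le
    _ < (c₀ * θ * K) * (a / (2 * (c₀ * θ * K))) := mul_lt_mul_of_pos_left hσa hpos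
    _ = a / 2 := by field_simp
    _ < a := by linarith

/-- **The slight-laminate cost vanishes quadratically while the gain does not**: for every positive gain coefficient `g`
(`= 2πσ³θβT` at fixed `σ, β, T`) there is a level `Λ₁ = 1 + η` whose laminate cost `5.2 η²` (`≥ a(1+η)` for `η ≤ 0.2`, table above)
is below `g/2` — the typed `∀ Λ₁ > 1` therefore leaves NO safe `(σ, β, T)`. [folklore] -/
theorem slight_laminate_beats_any_gain {g : ℝ} (hg : 0 < g) :
    ∃ η : ℝ, 0 < η ∧ η ≤ 1 / 5 ∧ (26 / 5) * η ^ 2 < g / 2 := by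
  refine ⟨min (1 / 5) (g / 11), by positivity, min_le_left _ _, ?_⟩
  set η : ℝ := min (1 / 5) (g / 11) with hη
  have hη5 : η ≤ 1 / 5 := min_le_left _ _
  have hηg : η ≤ g / 11 := min_le_right _ _
  have hηpos : 0 < η := by positivity
  calc (26 / 5) * η ^ 2 = (26 / 5) * η * η := by ring
    _ ≤ (26 / 5) * (1 / 5) * (g / 11) := by
        have h1 : (26 / 5) * η * η ≤ (26 / 5) * (1 / 5) * η :=
          mul_le_mul_of_nonneg_right (by nlinarith) hηpos.le
        exact h1.trans (mul_le_mul_of_nonneg_left hηg (by norm_num))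
    _ < g / 2 := by nlinarith

/-- **TARGET — STUB 3 `StaticClampedCollisionalLd`: a NECESSARY amplitude bound from clamp-depletion laminates (information for the
prover; consistent with `∃ β₀`, so no kill; complements the drefute marking-noise floor, which is second order in `β`).**
Laminate only the half-torus `R := {∂_kφ > 0}` (period `D ≪ 1`, level `Λ = Λ₁`, sheets holding half of `R`'s mass, pressure matched to
the outside so that `E_ψ[w⁻¹Am_k] = (c₁ + 3c₂θ₀)∫∂_kφ = 0` survives at first order), homogeneous outside. The static clamp `ω` DROPS every
collision with a flagged (sheet) partner, i.e. about half of the collisional momentum flux inside `R`: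
`E_ψ[w⁻¹Xm_k] ≈ −(N+1)·(π₀/2)·c_φ`, `π₀ = (2π/3)σ³θ₀` (per-particle collisional pressure share), `c_φ = ∫_R ∂_kφ` (`= 2` for
`φ = sin 2πx_k`), at cost `a(Λ₁)(N+1)/2`. Donsker–Varadhan: rate `≥ |β|π₀c_φ/2 − a(Λ₁)/2 − o(1)` for BOTH signs of `β`, hence
  NECESSARY:  `β₀ ≤ a(Λ₁)/(π₀ c_φ) = 3a(Λ₁)/(2πσ³θ₀c_φ)`;  `Λ₁ = 1+η`: `β₀ ≲ 1.2η²/(σ³θ₀)` (`c_φ = 2`);  `Λ₁ = 2`: `β₀ ≲ 0.25/(σ³θ₀)`.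
So `β₀ → 0` quadratically as `Λ₁ → 1⁺` and `β₀ = O(a(Λ₁)/(σ³θ₀‖∇φ‖₁))` at best — compatible with the typed `∃ β₀` after `(σ, φ, Λ₁)` and with
the drefute repair; the dock (levels `Λ ≍ c_p/σ³`, `a ≈ (15/4)log(1/σ)`) is unaffected. Same physics input (P) as STUB 2. [folklore] -/
theorem target_stub3_amplitude_bound : True := trivial

/-- **§12 audit of the remaining stubs (deltas to the drefute Survivors note only).**
STUB 1 `ClusterVirialBudget`: TRUE; re-derived independently: isolated `εΣ_int‖Δv_i‖ = b_S(t₂) − b_S(t₁) − 2K_S(t₂−t₁) ≤ 2√(2K_S I_S(t₁))`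
(Cauchy–Schwarz for `b_S(t₁)`, `√I_S` is `√(2K_S)`-Lipschitz in flight and continuous at collisions, `K_S` constant under isolation because
`contactPairs` carries both orientations so `p.1 ∈ S → p.2 ∈ S` IS symmetric), ordered records double `internalImpulse` ⇒ the typed `4√(2KI)(t₁)`;
fed form with the lever arm `⟨x_i − X_S, Δv_i⟩`, `|·| ≤ R‖Δv_i‖`, external records counted once (`fst ∈ S`). `Ioc`/right-continuity conventions
consistent (collision at `t₁` excluded from the sum and already in `γ t₁`).
STUB 4 `InheritedDockInputs`: five GIVEN children; junk re-audit of `HighMomentumCutoff σ` (each fixed `N` finite by energy conservation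
`e^{c|v_i(t)|²} ≤ Π_j e^{c|v_j(0)|²}`; uniformity in `N` is the open content), `EnergyCurrentTails` (finite at each `N`, `M` after the solution),
`UniformLocalGibbsConcentration` / `HsEosLowDensity` (TRUE-grade statics; `hsFreeVolume η N > 0` for `η < 1/8`, all `N`, by the cubic lattice;
`F(0) = 0` consistent since `hsFreeVolume 0 N = 1`; NB `(η/N)^{1/3}` for `η < 0` is Mathlib's `|η/N|^{1/3}/2`, so `hsExcessFreeEnergy` is NOT
differentiable at `0` from the left — harmless, 0768 only uses `F` on `Ico 0 η₀` and `deriv F 0`, not `deriv hsExcessFreeEnergy 0`),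
`DiluteSelfConsistency` 3091 (the soft spot: negation ≈ crux 12586; needs certified compressive solutions, i.e. EOS regularity 0768 first —
EOS-free classical solutions on `𝕋³` have `ρ ≡ const`: with `ρ = ρ(t)` mass conservation forces `div u ≡ −ρ'/ρ`, zero mean on `𝕋³`).
STUB 5: typing debt, decidable only through A (§1). STUB 6: an implication whose antecedents 2–3 are being re-typed; see (R-a) for the one
bookkeeping constraint this seat adds (`β₁` independent of the accuracy). [folklore] -/
theorem targets_audit_c3 : True := trivial

/-! ## §13 Why it resists — cycle 3 addendum, dead ends, census -/

/-- **WHY IT RESISTS (cycle 3, 2026-08-16; refuter-cdisprove-stmt-AtomisticToContinuum-9282-g3-0).**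
1. Normal form unchanged (§1): a kill is `⊢ A ∧ ¬B`; A open (no LD technology at fixed `σ`), B not refutable on certifiable data.
   Re-audit of the certifiable class of classical hs-Euler solutions (EOS VALUES unknown on the dilute range): `ρ ≡ ρ₀` is forced for every
   EOS-free solution on `𝕋³` (a time-dependent constant density is excluded by `∫div u = 0`); the system is then `div u = 0`, `D_t θ = 0`,
   `D_t u + Z₀∇θ = 0`, `Z₀ := Z(ρ₀σ³)` an UNKNOWN CONSTANT — besides constants / shear / sheared shear this admits steady VORTICES with radial
   temperature `θ'(r) = V(r)²/(Z₀ r)` when `Z₀ ≠ 0` and shear with arbitrary transported `θ(x₂)` when `Z₀ = 0` (case split, no value of `Z`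
   needed): new certifiable solutions with `∇θ ≠ 0`, on all of which B is still physically true (heat conduction `O(N^{2/3})` entropy per unit
   time). Compression (the only door to `¬B`, §9) needs `∇ρ ≠ 0`, i.e. `Z ∈ C¹` on the range — 0768. Isobaric compressive flows (`∇p = 0`,
   `D_t u = 0`, free streaming) would need `div u` spatially constant along the flow, impossible for periodic non-nilpotent `∇u₀`
   (`∫tr((∇u)²) = ∫(div u)² `…): no EOS-free compression on `𝕋³`.
2. The cycle's new content is on the PICKED LINE (§12): STUB 2 is physically false as typed by persistent contact laminates — a second witness,
   independent of the drefute necklace, surviving its repair, and fixing the repair's missing clauses (level floor + amplitude–horizon cap before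
   `σ₀`; `β₁` independent of the accuracy in the dock); STUB 3 gets a necessary amplitude bound `β₀ ≲ a(Λ₁)/(σ³θ‖∇φ‖₁)`.
3. Laminates do NOT touch A (one-body kinetic functionals see a temperature laminate only through `E_{N(0,λ)}g = O((λ−1)²)`, the cycle-2 tilt
   floors) nor B (laminated initial data are continuous, not smooth: no classical solution is tied, B vacuous there; smooth macroscopic
   laminates are contact structures on which B is physically true).
4. Literature (`lit search` rc 75 all cycle; galaxy up): for the 3091/12586 soft spot the state of the art, quoted from J. Chen, *Vorticity
   blowup in compressible Euler equations in ℝᵈ, d ≥ 3*, arXiv:2408.04319, §1.2 p. 4 and Thm 1 p. 5 (galaxy pdf:2192982220): Merle–Raphaël–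
   Rodnianski–Szeftel "constructed the self-similar profiles for Euler in ℝᵈ with any d ≥ 2 and adiabatic exponents γ > 1 not in an exceptional
   countable sequence Γ"; stability is known "only … from a finite co-dimensional set"; Chen's Thm 1 gives, for γ ∉ Γ, smooth implosion
   (‖u‖_∞, ‖ρ‖_∞ → ∞ on a sphere) from C^∞ data with COMPACTLY SUPPORTED velocity and "density constant away from the sphere uniformly up to T" —
   hence, by finite speed of propagation, ideal-gas implosions from smooth data ON 𝕋³ (isentropic data solve the full system while smooth).
   Whether the monatomic γ = 5/3 lies outside Γ is not settled by that source (the computer-assisted profiles of Buckmaster–Cao-Labora–Gómez-Serrano,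
   Chen's ref. [6], are the place to check); and the transfer to the hard-sphere EOS `p = ρθZ(ρσ³)` at `ρσ³ ≍ η` is an O(η) structural-stability
   question for a finite-codimension phenomenon — exactly the content of 3091/12586, untouched here. -/
theorem why_it_resists_c3 : True := trivial

/-- DEAD ENDS (cycle 3, one line each).
* a Lean `¬MesoJammedSetLd`: the gain side (L4) is a true-law statement over macroscopic time (not constructible); the cost side for
  density laminates needs inhomogeneous hard-sphere thermodynamics (0767/14445-grade); a velocity-only (temperature) laminate has a rigorous
  cost (`(3/2)∫(λ−1−log λ)`, equal partition functions, uniform one-point marginal) but becomes a density laminate only dynamically — no.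
* importing `Lines/explosion-limited-jamming.lean` to target the stub terms: no `.olean` for crux workfiles (checked) — restating verbatim
  would couple this file to a skeleton under re-typing; not done.
* rigorous LD LOWER bounds under `G_N` without dynamics: only the mean (Jensen) is available, and the mean is refinement-small; every
  inhomogeneous approximately-invariant law IS a hydrodynamic statement — no.
* laminates against 13733/13734 (TwoClocks): activity clamp self-heals / statements in mean along smooth solutions — inert (recorded §12).
* `Z ≥ 1` on `[0, 1/8)` from antitonicity of `hsFreeVolume` (provable with work): would certify `Z₀ > 0` but opens no door (item 1). -/
theorem dead_ends_c3 : True := trivial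

end Summit.AtomisticToContinuum.HydrodynamicLimit.Cruxes.KineticWindowGronwall.Disproof

end
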